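import Mathlib.Analysis.Calculus.Deriv.MeanValue
import Mathlib.Analysis.Calculus.Deriv.Slope
import Mathlib.Topology.Order.IntermediateValue
import Mathlib.Order.Monotone.Union
import Literature.Geometry.Lorentzian.KerrSeparatedPotential
import HarnessLib

/-!
# The structure of trapping for Carter's potential `V₀` on subextremal Kerr
# (DRSR §6.3–6.5: Lemmas 6.3.1, 6.3.2 (ii), 6.4.1, 6.4.2, 6.5.1), proved

(family `gr`, infrastructure for statement **gr.S24**; namespace `Literature.Geometry.Lorentzian.Kerr`)

This file completes the formalisation of §6 ("Properties of the potential `V`") of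
Dafermos–Rodnianski–Shlapentokh-Rothman, *Decay for solutions of the wave equation on Kerr exterior
spacetimes III*, arXiv:1402.7034 = Ann. of Math. 183 (2016), begun in
`KerrSeparatedPotential.lean` (which has Def. 6.1.1, `V = V₀ + V₁`, `V₁ ≥ 0`, Lemma 6.3.2 (i) and
the first assertion of Lemma 6.4.1). Everything here is **proved** (one-variable real analysis of
the rational function `V₀(r) = (4Mramω − a²m² + ΔΛ)/(r² + a²)²` on `r > r₊`), with the constants
that the source leaves implicit ("`B`", "`b`", "`c`", "sufficiently small") made explicit:

* `Kerr.critPoly` — the cubic `P(r) = (r² + a²)³ dV₀/dr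
  = 4maMω(−3r² + a²) + 4ra²m² − 2Λ(r³ + a²r − 3Mr² + Ma²)` of the proof of Lemma 6.3.1 (first
  display; `deriv_sepPotential₀_eq`) and its derivative `Kerr.critPolyDeriv`
  `= −24Mamω r + 4a²m² − 2Λ(3r² − 6Mr + a²)` (second display). The printed root analysis
  ("`r₂ < r₊`, so `r₁` is the only possible zero of `dP/dr` on `[r₊, ∞)`") is replaced by the
  equivalent elementary fact `critPolyDeriv_neg_of_nonpos`: on `[r₊, ∞)`, once `P' ≤ 0` it stays
  `< 0`; whence a turning point `c ∈ [r₊, 5M]` with `P` strictly increasing on `[r₊, c]` and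
  strictly decreasing on `[c, ∞)` (`exists_critPoly_turningPoint`), and `P < 0` on `[7M, ∞)`
  (`critPoly_neg_of_seven_mul_le`, from `Λ ≥ 2|amω|`, `Λ ≥ m²`).
* **Lemma 6.3.1** (`sepPotential₀_trichotomy`): for `|a| < M`, an admissible triple and `Λ > 0`,
  `V₀` on `(r₊, ∞)` is either (a) strictly decreasing, or (b) `dV₀/dr > 0` on `(r₊, r⁰_max)`,
  `= 0` at `r⁰_max`, `< 0` on `(r⁰_max, ∞)` (so `r⁰_max` is the unique critical point and the global
  maximum, `sepPotential₀_isMaxOn_of_deriv_sign`), or (c) `dV₀/dr < 0`, `= 0`, `> 0`, `= 0`, `< 0`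
  on `(r₊, r⁰_min)`, `r⁰_min`, `(r⁰_min, r⁰_max)`, `r⁰_max`, `(r⁰_max, ∞)` (a local minimum and a local
  maximum, `sepPotential₀_isLocalMin_isLocalMax_of_deriv_sign`); in (b), (c) moreover
  `r⁰_max < B := 7M` (`deriv_sepPotential₀_neg_of_seven_mul_le`). The source states the lemma for
  `0 ≤ a ≤ a₀ < M`; only `|a| < M` is used.
* **Lemma 6.3.2, second clause** (`sepPotential₀_lt_sq_of_deriv_neg`): `ω² > V₀(r⁰_min)`.
* **Lemma 6.4.1, second assertion** (`sepPotential₀_caseB_of_deriv_rPlus_pos`,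
  `sepPotential₀_caseB_of_superradiant`): if `dV₀/dr(r₊) > 0` — in particular for `0 ≤ a < M`
  and `mω ≤ am²/(2Mr₊) + αΛ` with `4aMα(3r₊² − a²) < 4(r₊ − M)(Mr₊ − a²)` — then `r⁰_min` is absent:
  case (b). The `α`-variant of the horizon bound is explicit:
  `dV₀/dr(r₊) ≥ (4(r₊ − M)(Mr₊ − a²) − 4aMα(3r₊² − a²))Λ/(r₊² + a²)³`
  (`le_deriv_sepPotential₀_rPlus_alpha`).
* **Lemma 6.4.2** (superradiant frequencies are not trapped; `exists_sepPotential₀_sub_sq_ge`,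
  `exists_sepPotential₀_rmax_sub_sq_ge`): for `0 < M`, `0 ≤ a < M` there is `b = b(M, a) > 0`
  with `V₀(r⁰_max) − ω² ≥ bΛ` for every admissible triple with `0 < mω ≤ am²/(2Mr₊)`, following the
  printed three cases (near the threshold `ω = ω₊m`: the horizon slope of Lemma 6.4.1 and a mean
  value inequality; `ω²` small: the point `r = 4M`; otherwise: the point `r₀ = am/(2Mω)` and the
  printed identity `ω² − V₀(r₀) = Δ(r₀)((a²m²/4M²)(1 + 2M/r₀ + a²/r₀²) − Λ)/(r₀² + a²)²`,
  `sepPotential₀_sub_sq_eq_of`).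
* **Lemma 6.5.1** (`deriv_sepPotential₀_pos_trappingRadius`, `exists_rmax_gt_trappingRadius`):
  if `12M²|amω| ≤ (M² − a²)Λ` (i.e. `|σ| ≤ c` with the explicit `c = (1 − a²/M²)/12`) then
  `dV₀/dr((1 + √2)M) > 0`, so case (a) is excluded and `r⁰_max > (1 + √2)M`
  (`(1 + √2)² = 3 + 2√2`, `(1 + √2)³ = 7 + 5√2` as printed).

Deviations, all on the side of generality and recorded on the declarations: (i) Lemma 6.4.2 is
proved for `α = 0` only (the superradiant regime proper; the source's "for all `α ≥ 0`
sufficiently small" extension is not transcribed), and its constant `b` is produced for each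
`(M, a)` — the uniformity in `a ∈ [0, a₀]` asserted in the source (constants depending on `a₀`, `M`)
is visible from the explicit formulas but not packaged; (ii) in Lemma 6.5.1 the printed
hypotheses `m² ≤ cΛ`, `c⁻¹ ≤ Λ` are unnecessary for `V₀` (the term `4ra²m²` of `P` has a
favourable sign) and are dropped; (iii) Lemma 6.3.1 and 6.5.1 are stated for `|a| < M`
(`Kerr.IsSubextremal`) rather than `0 ≤ a ≤ a₀ < M`.

## References

* M. Dafermos, I. Rodnianski, Y. Shlapentokh-Rothman, arXiv:1402.7034 = Ann. of Math. 183 (2016):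
  §6.2 (`V₀`), Lemma 6.3.1 and its proof, Lemma 6.3.2, Lemma 6.4.1 and its proof, Lemma 6.4.2 and
  its proof, Lemma 6.5.1 and its proof, Remark 6.5.1 (key `DafermosRodnianskiShlapentokhrothman2014`).
-/

noncomputable section

namespace Literature.Geometry.Lorentzian

namespace Kerr

open Set

/-! ### The cubic `P = (r² + a²)³ dV₀/dr` and its derivative -/

/-- The **critical-point cubic** `P(r) = (r² + a²)³ dV₀/dr
= 4maMω(−3r² + a²) + 4ra²m² − 2Λ(r³ + a²r − 3Mr² + Ma²)`: its zeros on `(r₊, ∞)` are exactly the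
critical points of `V₀` there (`deriv_sepPotential₀_eq`). DRSR arXiv:1402.7034, proof of
Lemma 6.3.1 (first display). [cite: DafermosRodnianskiShlapentokhrothman2014, Lemma 6.3.1 (proof)] -/
def critPoly (M a ω : ℝ) (m : ℤ) (Λ r : ℝ) : ℝ :=
  4 * m * a * M * ω * (-3 * r ^ 2 + a ^ 2) + 4 * r * a ^ 2 * (m : ℝ) ^ 2 -
    2 * Λ * (r ^ 3 + a ^ 2 * r - 3 * M * r ^ 2 + M * a ^ 2)

/-- The derivative `dP/dr = −24Mamω r + 4a²m² − 2Λ(3r² − 6Mr + a²)` of the critical-point cubic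
(a downward parabola for `Λ > 0`). DRSR arXiv:1402.7034, proof of Lemma 6.3.1 (second display).
[cite: DafermosRodnianskiShlapentokhrothman2014, Lemma 6.3.1 (proof)] -/
def critPolyDeriv (M a ω : ℝ) (m : ℤ) (Λ r : ℝ) : ℝ :=
  -24 * M * a * m * ω * r + 4 * a ^ 2 * (m : ℝ) ^ 2 - 2 * Λ * (3 * r ^ 2 - 6 * M * r + a ^ 2)

/-- `dP/dr = critPolyDeriv` (differentiating the cubic). DRSR arXiv:1402.7034, proof of
Lemma 6.3.1 (second display). [cite: DafermosRodnianskiShlapentokhrothman2014, Lemma 6.3.1 (proof)] -/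
theorem hasDerivAt_critPoly (M a ω : ℝ) (m : ℤ) (Λ r : ℝ) :
    HasDerivAt (critPoly M a ω m Λ) (critPolyDeriv M a ω m Λ r) r := by
  have h := ((((hasDerivAt_pow 3 r).const_mul (-2 * Λ)).add
    ((hasDerivAt_pow 2 r).const_mul (6 * Λ * M - 12 * M * a * m * ω))).add
    ((hasDerivAt_id r).const_mul (4 * a ^ 2 * (m : ℝ) ^ 2 - 2 * Λ * a ^ 2))).add_const
    (4 * m * a * M * ω * a ^ 2 - 2 * Λ * M * a ^ 2)
  have h' : HasDerivAt (critPoly M a ω m Λ)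
      (-2 * Λ * (↑(3 : ℕ) * r ^ (3 - 1)) +
        (6 * Λ * M - 12 * M * a * m * ω) * (↑(2 : ℕ) * r ^ (2 - 1)) +
        (4 * a ^ 2 * (m : ℝ) ^ 2 - 2 * Λ * a ^ 2) * 1) r := by
    refine h.congr_of_eventuallyEq (Filter.Eventually.of_forall fun s ↦ ?_)
    simp only [critPoly, id, Pi.add_apply]
    ring
  refine h'.congr_deriv ?_
  simp only [critPolyDeriv]
  push_cast
  ring

/-- `P` is continuous (a polynomial). [folklore] -/
theorem continuous_critPoly (M a ω : ℝ) (m : ℤ) (Λ : ℝ) : Continuous (critPoly M a ω m Λ) := by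
  unfold critPoly; fun_prop

/-- `dP/dr` is continuous (a polynomial). [folklore] -/
theorem continuous_critPolyDeriv (M a ω : ℝ) (m : ℤ) (Λ : ℝ) :
    Continuous (critPolyDeriv M a ω m Λ) := by
  unfold critPolyDeriv; fun_prop

/-- `deriv P = critPolyDeriv`. DRSR arXiv:1402.7034, proof of Lemma 6.3.1 (second display).
[cite: DafermosRodnianskiShlapentokhrothman2014, Lemma 6.3.1 (proof)] -/
theorem deriv_critPoly (M a ω : ℝ) (m : ℤ) (Λ r : ℝ) :
    deriv (critPoly M a ω m Λ) r = critPolyDeriv M a ω m Λ r :=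
  (hasDerivAt_critPoly M a ω m Λ r).deriv

/-- `dV₀/dr = P/(r² + a²)³` wherever `r² + a² ≠ 0` (restating `hasDerivAt_sepPotential₀` of
`KerrSeparatedPotential.lean` through `critPoly`). DRSR arXiv:1402.7034, proof of Lemma 6.3.1
(first display). [cite: DafermosRodnianskiShlapentokhrothman2014, Lemma 6.3.1 (proof)] -/
theorem hasDerivAt_sepPotential₀_critPoly (M a ω : ℝ) (m : ℤ) (Λ : ℝ) {r : ℝ}
    (hr : r ^ 2 + a ^ 2 ≠ 0) :
    HasDerivAt (sepPotential₀ M a ω m Λ) (critPoly M a ω m Λ r / (r ^ 2 + a ^ 2) ^ 3) r :=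
  hasDerivAt_sepPotential₀ M a ω m Λ hr

/-- `deriv V₀ r = P(r)/(r² + a²)³` wherever `r² + a² ≠ 0`. DRSR arXiv:1402.7034, proof of
Lemma 6.3.1 (first display). [cite: DafermosRodnianskiShlapentokhrothman2014, Lemma 6.3.1 (proof)] -/
theorem deriv_sepPotential₀_eq (M a ω : ℝ) (m : ℤ) (Λ : ℝ) {r : ℝ} (hr : r ^ 2 + a ^ 2 ≠ 0) :
    deriv (sepPotential₀ M a ω m Λ) r = critPoly M a ω m Λ r / (r ^ 2 + a ^ 2) ^ 3 :=
  (hasDerivAt_sepPotential₀_critPoly M a ω m Λ hr).deriv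

/-- For `r > 0`: `dV₀/dr > 0 ↔ P > 0` (the denominator `(r² + a²)³` is positive). DRSR
arXiv:1402.7034, proof of Lemma 6.3.1. [cite: DafermosRodnianskiShlapentokhrothman2014, Lemma 6.3.1 (proof)] -/
theorem deriv_sepPotential₀_pos_iff (M a ω : ℝ) (m : ℤ) (Λ : ℝ) {r : ℝ} (hr : 0 < r) :
    0 < deriv (sepPotential₀ M a ω m Λ) r ↔ 0 < critPoly M a ω m Λ r := by
  have hA : 0 < (r ^ 2 + a ^ 2) ^ 3 := by positivity
  rw [deriv_sepPotential₀_eq M a ω m Λ (by positivity), div_pos_iff_of_pos_right hA]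

/-- For `r > 0`: `dV₀/dr < 0 ↔ P < 0`. DRSR arXiv:1402.7034, proof of Lemma 6.3.1.
[cite: DafermosRodnianskiShlapentokhrothman2014, Lemma 6.3.1 (proof)] -/
theorem deriv_sepPotential₀_neg_iff (M a ω : ℝ) (m : ℤ) (Λ : ℝ) {r : ℝ} (hr : 0 < r) :
    deriv (sepPotential₀ M a ω m Λ) r < 0 ↔ critPoly M a ω m Λ r < 0 := by
  have hA : 0 < (r ^ 2 + a ^ 2) ^ 3 := by positivity
  rw [deriv_sepPotential₀_eq M a ω m Λ (by positivity), div_neg_iff]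
  constructor
  · rintro (⟨_, h⟩ | ⟨h, _⟩)
    · exact absurd h (not_lt.2 hA.le)
    · exact h
  · exact fun h ↦ Or.inr ⟨h, hA⟩

/-- For `r > 0`: `dV₀/dr = 0 ↔ P = 0` (critical points of `V₀` are the zeros of `P`). DRSR
arXiv:1402.7034, proof of Lemma 6.3.1. [cite: DafermosRodnianskiShlapentokhrothman2014, Lemma 6.3.1 (proof)] -/
theorem deriv_sepPotential₀_eq_zero_iff (M a ω : ℝ) (m : ℤ) (Λ : ℝ) {r : ℝ} (hr : 0 < r) :
    deriv (sepPotential₀ M a ω m Λ) r = 0 ↔ critPoly M a ω m Λ r = 0 := by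
  have hA : 0 < (r ^ 2 + a ^ 2) ^ 3 := by positivity
  rw [deriv_sepPotential₀_eq M a ω m Λ (by positivity), div_eq_zero_iff, or_iff_left hA.ne']

/-- `V₀` is continuous on every subset of `(0, ∞)` (it is differentiable wherever `r² + a² ≠ 0`).
[folklore] -/
theorem continuousOn_sepPotential₀ (M a ω : ℝ) (m : ℤ) (Λ : ℝ) {s : Set ℝ} (hs : s ⊆ Ioi 0) :
    ContinuousOn (sepPotential₀ M a ω m Λ) s := fun r hr ↦
  (hasDerivAt_sepPotential₀ M a ω m Λ (r := r)
    (by have := hs hr; rw [mem_Ioi] at this; positivity)).continuousAt.continuousWithinAt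

/-- `r₊ > M` for subextremal parameters (a local copy of `IsSubextremal.M_lt_rPlus` of
`KerrHyperboloidalFlux.lean`, which is not importable here: that file is downstream of heavier
prelude modules). O'Neill 1995, Ch. 2, §2.3. [folklore] -/
private theorem M_lt_rPlus' {M a : ℝ} (hMa : IsSubextremal M a) : M < rPlus M a := by
  have ha2 : a ^ 2 < M ^ 2 := sq_lt_sq' (abs_lt.1 hMa).1 (abs_lt.1 hMa).2
  have : 0 < √(M ^ 2 - a ^ 2) := Real.sqrt_pos.2 (by nlinarith)
  unfold rPlus; linarith

/-- `r₊ ≤ 2M` for `0 ≤ M` (a local copy of `rPlus_le_two_mul` of `KerrHyperboloidalLeaves.lean`,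
not importable here for the same reason). [folklore] -/
private theorem rPlus_le_two_mul' {M : ℝ} (hM : 0 ≤ M) (a : ℝ) : rPlus M a ≤ 2 * M := by
  have h1 : √(M ^ 2 - a ^ 2) ≤ √(M ^ 2) := Real.sqrt_le_sqrt (by nlinarith [sq_nonneg a])
  rw [Real.sqrt_sq hM] at h1
  unfold rPlus; linarith

/-- `r₊ > 0` for subextremal parameters. [folklore] -/
private theorem rPlus_pos' {M a : ℝ} (hMa : IsSubextremal M a) : 0 < rPlus M a :=
  hMa.pos.trans (M_lt_rPlus' hMa)

/-! ### Sign information on `P` and `dP/dr` (proof of Lemma 6.3.1) -/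

/-- **`P(r) < 0` for `r ≥ 7M`** (`|a| < M`, admissible triple, `Λ > 0`): with `Λ ≥ 2|amω|`,
`Λ ≥ m²` one has `P ≤ 2Λr(−r² + 6Mr + a²) − 4ΛMa² < 0`. This is the source's "last statement of
the lemma" (`r⁰_max ≤ B`, from the leading behaviour `(6ΛM − 12Mamω)r² − 2Λr³ + O(amω, m²)r`),
with the explicit `B = 7M`. DRSR arXiv:1402.7034, Lemma 6.3.1 (proof, last paragraph).
[cite: DafermosRodnianskiShlapentokhrothman2014, Lemma 6.3.1 (proof)] -/
theorem critPoly_neg_of_seven_mul_le {M a ω Λ r : ℝ} {m : ℤ} (hMa : IsSubextremal M a)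
    (hadm : IsAdmissibleTriple a ω m Λ) (hΛ : 0 < Λ) (hr : 7 * M ≤ r) :
    critPoly M a ω m Λ r < 0 := by
  have hM := hMa.pos
  have ha2 : a ^ 2 < M ^ 2 := sq_lt_sq' (abs_lt.1 hMa).1 (abs_lt.1 hMa).2
  have hr0 : 0 < r := by linarith
  have h3 : 0 ≤ 3 * r ^ 2 - a ^ 2 := by nlinarith
  have hp2 := hadm.2
  have T1 : 4 * m * a * M * ω * (-3 * r ^ 2 + a ^ 2) ≤ 2 * M * Λ * (3 * r ^ 2 - a ^ 2) :=
    calc 4 * m * a * M * ω * (-3 * r ^ 2 + a ^ 2)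
        = 4 * M * (-(a * m * ω)) * (3 * r ^ 2 - a ^ 2) := by ring
      _ ≤ 4 * M * |a * m * ω| * (3 * r ^ 2 - a ^ 2) := by gcongr; exact neg_le_abs _
      _ ≤ 4 * M * (Λ / 2) * (3 * r ^ 2 - a ^ 2) := by gcongr; linarith
      _ = 2 * M * Λ * (3 * r ^ 2 - a ^ 2) := by ring
  have T2 : 4 * r * a ^ 2 * (m : ℝ) ^ 2 ≤ 4 * r * a ^ 2 * Λ :=
    mul_le_mul_of_nonneg_left hadm.sq_le
      (mul_nonneg (mul_nonneg (by norm_num) hr0.le) (sq_nonneg a))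
  have hkey : 0 < r ^ 2 - 6 * M * r - a ^ 2 := by nlinarith
  have hprod : 0 < Λ * (r * (r ^ 2 - 6 * M * r - a ^ 2)) := mul_pos hΛ (mul_pos hr0 hkey)
  have h4 : 0 ≤ Λ * (M * a ^ 2) := mul_nonneg hΛ.le (mul_nonneg hM.le (sq_nonneg a))
  unfold critPoly
  linarith

/-- **`dP/dr(t) < 0` for `t ≥ 5M`** (`|a| < M`, admissible triple, `Λ > 0`):
`dP/dr ≤ Λ(−6t² + 24Mt + 2a²) < 0`; this is the source's `lim_{r→∞} (r² + a²)³ dV₀/dr = −∞`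
made quantitative. DRSR arXiv:1402.7034, Lemma 6.3.1 (proof). [cite: DafermosRodnianskiShlapentokhrothman2014, Lemma 6.3.1 (proof)] -/
theorem critPolyDeriv_neg_of_five_mul_le {M a ω Λ t : ℝ} {m : ℤ} (hMa : IsSubextremal M a)
    (hadm : IsAdmissibleTriple a ω m Λ) (hΛ : 0 < Λ) (ht : 5 * M ≤ t) :
    critPolyDeriv M a ω m Λ t < 0 := by
  have hM := hMa.pos
  have ha2 : a ^ 2 < M ^ 2 := sq_lt_sq' (abs_lt.1 hMa).1 (abs_lt.1 hMa).2
  have ht0 : 0 < t := by linarith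
  have hp2 := hadm.2
  have T1 : -24 * M * a * m * ω * t ≤ 12 * M * Λ * t :=
    calc -24 * M * a * m * ω * t = 24 * M * t * (-(a * m * ω)) := by ring
      _ ≤ 24 * M * t * |a * m * ω| := by gcongr; exact neg_le_abs _
      _ ≤ 24 * M * t * (Λ / 2) := by gcongr; linarith
      _ = 12 * M * Λ * t := by ring
  have T2 : 4 * a ^ 2 * (m : ℝ) ^ 2 ≤ 4 * a ^ 2 * Λ :=
    mul_le_mul_of_nonneg_left hadm.sq_le (by positivity)
  have hkey : 0 < 6 * t ^ 2 - 24 * M * t - 2 * a ^ 2 := by nlinarith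
  have hprod : 0 < Λ * (6 * t ^ 2 - 24 * M * t - 2 * a ^ 2) := mul_pos hΛ hkey
  unfold critPolyDeriv
  linarith

/-- **Unimodality of `P` on `[r₊, ∞)`**: if `dP/dr(r) ≤ 0` at some `r ≥ r₊` then `dP/dr(t) < 0`
for all `t > r` (`|a| < M`, `Λ > 0`). Writing `dP/dr(x) = −6Λx² + βx + γ`,
`β = 12ΛM − 24Mamω`, one has `dP/dr(t) − dP/dr(r) = (t − r)(β − 6Λ(t + r))`; if the bracket were
`≥ 0` then `βr > 12Λr²` and `dP/dr(r) > 6Λr² − 2Λa² > 0`. This replaces the source's root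
discussion "`Re r₂ < r₊`, so `r₁` is the only possible zero of `d/dr((r² + a²)³ dV₀/dr)` on
`[r₊, ∞)`" (both signs of `mω`). DRSR arXiv:1402.7034, Lemma 6.3.1 (proof).
[cite: DafermosRodnianskiShlapentokhrothman2014, Lemma 6.3.1 (proof)] -/
theorem critPolyDeriv_neg_of_nonpos {M a ω Λ r t : ℝ} {m : ℤ} (hMa : IsSubextremal M a)
    (hΛ : 0 < Λ) (hr : rPlus M a ≤ r) (hPr : critPolyDeriv M a ω m Λ r ≤ 0) (hrt : r < t) :
    critPolyDeriv M a ω m Λ t < 0 := by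
  have hM := hMa.pos
  have hrM : M < r := (M_lt_rPlus' hMa).trans_le hr
  have hr0 : 0 < r := hM.trans hrM
  have har : a ^ 2 < r ^ 2 := by
    have : |a| < r := lt_of_lt_of_le hMa hrM.le
    nlinarith [abs_nonneg a, sq_abs a]
  set β := 12 * Λ * M - 24 * M * (a * m * ω) with hβ
  have eP : ∀ x, critPolyDeriv M a ω m Λ x =
      -6 * Λ * x ^ 2 + β * x + (4 * a ^ 2 * (m : ℝ) ^ 2 - 2 * Λ * a ^ 2) := by
    intro x; simp only [critPolyDeriv, hβ]; ring
  have key : critPolyDeriv M a ω m Λ t =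
      critPolyDeriv M a ω m Λ r + (t - r) * (β - 6 * Λ * (t + r)) := by
    rw [eP t, eP r]; ring
  rcases lt_or_ge (β - 6 * Λ * (t + r)) 0 with h | h
  · have : (t - r) * (β - 6 * Λ * (t + r)) < 0 := mul_neg_of_pos_of_neg (sub_pos.2 hrt) h
    linarith
  · exfalso
    have h6 : 6 * Λ * (t + r) * r ≤ β * r := mul_le_mul_of_nonneg_right (by linarith) hr0.le
    have h7 : 0 < Λ * ((t - r) * r) := mul_pos hΛ (mul_pos (sub_pos.2 hrt) hr0)
    have h1 : 12 * Λ * r ^ 2 < β * r := by nlinarith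
    have h2 : 0 < Λ * (r ^ 2 - a ^ 2) := mul_pos hΛ (by linarith)
    have h3 : 0 ≤ a ^ 2 * (m : ℝ) ^ 2 := by positivity
    have h4 : 0 ≤ Λ * r ^ 2 := by positivity
    have h5 := eP r
    linarith

/-- **The turning point of `P`.** For `|a| < M`, an admissible triple and `Λ > 0` there is
`c ∈ [r₊, 5M]` with `dP/dr > 0` on `[r₊, c)`, `dP/dr(c) ≤ 0` and `dP/dr < 0` on `(c, ∞)`
(`c = inf {x ∈ [r₊, 5M] : dP/dr(x) ≤ 0}`, a closed nonempty set). This is the source's dichotomy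
"the only possible critical point [of `P`] on `(r₊, ∞)` would be `r₁`". DRSR arXiv:1402.7034,
Lemma 6.3.1 (proof). [cite: DafermosRodnianskiShlapentokhrothman2014, Lemma 6.3.1 (proof)] -/
theorem exists_critPoly_turningPoint {M a ω Λ : ℝ} {m : ℤ} (hMa : IsSubextremal M a)
    (hadm : IsAdmissibleTriple a ω m Λ) (hΛ : 0 < Λ) :
    ∃ c, rPlus M a ≤ c ∧ c ≤ 5 * M ∧ (∀ r ∈ Ico (rPlus M a) c, 0 < critPolyDeriv M a ω m Λ r) ∧
      critPolyDeriv M a ω m Λ c ≤ 0 ∧ (∀ t ∈ Ioi c, critPolyDeriv M a ω m Λ t < 0) := by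
  have hM := hMa.pos
  set S : Set ℝ := Icc (rPlus M a) (5 * M) ∩ {x | critPolyDeriv M a ω m Λ x ≤ 0} with hS
  have hSc : IsClosed S :=
    isClosed_Icc.inter (isClosed_le (continuous_critPolyDeriv M a ω m Λ) continuous_const)
  have h5 : rPlus M a ≤ 5 * M := (rPlus_le_two_mul' hM.le a).trans (by linarith)
  have hSn : S.Nonempty := ⟨5 * M, ⟨h5, le_rfl⟩,
    (critPolyDeriv_neg_of_five_mul_le hMa hadm hΛ le_rfl).le⟩
  have hSb : BddBelow S := ⟨rPlus M a, fun x hx ↦ hx.1.1⟩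
  have hc : sInf S ∈ S := hSc.csInf_mem hSn hSb
  refine ⟨sInf S, hc.1.1, hc.1.2, fun r hr ↦ ?_, hc.2, fun t ht ↦
    critPolyDeriv_neg_of_nonpos hMa hΛ hc.1.1 hc.2 ht⟩
  by_contra hneg
  have hrS : r ∈ S := ⟨⟨hr.1, hr.2.le.trans hc.1.2⟩, not_lt.1 hneg⟩
  exact absurd (csInf_le hSb hrS) (not_le.2 hr.2)

/-! ### Lemma 6.3.1: the trichotomy -/

section Trichotomy

variable {M a ω Λ : ℝ} {m : ℤ}

/-- `V₀` is strictly decreasing on `(r₊, ∞)` as soon as `dV₀/dr < 0` there off one point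
`c ≥ r₊` (gluing strict antitonicity on `(r₊, c]` and `[c, ∞)`); used for case (a) of
Lemma 6.3.1, which includes the inflection case of the source's (b*). DRSR arXiv:1402.7034,
Lemma 6.3.1 (proof, "either `r_max` is an inflection point and `V₀` is again strictly
decreasing"). [cite: DafermosRodnianskiShlapentokhrothman2014, Lemma 6.3.1 (proof)] -/
theorem strictAntiOn_sepPotential₀_of_deriv_neg {c : ℝ} (hMa : IsSubextremal M a)
    (hc : rPlus M a ≤ c)
    (h : ∀ r ∈ Ioi (rPlus M a), r ≠ c → deriv (sepPotential₀ M a ω m Λ) r < 0) :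
    StrictAntiOn (sepPotential₀ M a ω m Λ) (Ioi (rPlus M a)) := by
  have hr0 := rPlus_pos' hMa
  have hcont : ContinuousOn (sepPotential₀ M a ω m Λ) (Ioi (rPlus M a)) :=
    continuousOn_sepPotential₀ M a ω m Λ (Ioi_subset_Ioi hr0.le)
  rcases eq_or_lt_of_le hc with rfl | hlt
  · exact strictAntiOn_of_deriv_neg (convex_Ioi _) hcont
      (by rw [interior_Ioi]; exact fun x hx ↦ h x hx (ne_of_gt hx))
  · have h1 : StrictAntiOn (sepPotential₀ M a ω m Λ) (Ioc (rPlus M a) c) :=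
      strictAntiOn_of_deriv_neg (convex_Ioc _ _) (hcont.mono Ioc_subset_Ioi_self)
        (by rw [interior_Ioc]; exact fun x hx ↦ h x hx.1 (ne_of_lt hx.2))
    have h2 : StrictAntiOn (sepPotential₀ M a ω m Λ) (Ici c) :=
      strictAntiOn_of_deriv_neg (convex_Ici _) (hcont.mono fun x hx ↦ hlt.trans_le hx)
        (by rw [interior_Ici]; exact fun x hx ↦ h x (hlt.trans hx) (ne_of_gt hx))
    rw [← Ioc_union_Ici_eq_Ioi hlt]
    exact h1.union h2 (isGreatest_Ioc hlt) isLeast_Ici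

/-- Case (b) of Lemma 6.3.1 from the turning-point data: if `P` increases strictly on `[r₊, c]`,
decreases strictly on `[c, ∞)`, `P(c) > 0` and `P(r₊) ≥ 0`, then `P > 0` on `(r₊, z)`, `P(z) = 0`,
`P < 0` on `(z, ∞)` for the unique zero `z ∈ (c, 7M)` (intermediate value theorem with
`P(7M) < 0`). DRSR arXiv:1402.7034, Lemma 6.3.1 (proof, case (b*)).
[cite: DafermosRodnianskiShlapentokhrothman2014, Lemma 6.3.1 (proof)] -/
private theorem caseB {c : ℝ} (hMa : IsSubextremal M a) (hadm : IsAdmissibleTriple a ω m Λ)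
    (hΛ : 0 < Λ) (hcp : rPlus M a ≤ c)
    (hmono : StrictMonoOn (critPoly M a ω m Λ) (Icc (rPlus M a) c))
    (hanti : StrictAntiOn (critPoly M a ω m Λ) (Ici c))
    (hPc : 0 < critPoly M a ω m Λ c) (hPp : 0 ≤ critPoly M a ω m Λ (rPlus M a)) :
    ∃ rmax, rPlus M a < rmax ∧ rmax < 7 * M ∧
      (∀ r ∈ Ioo (rPlus M a) rmax, 0 < deriv (sepPotential₀ M a ω m Λ) r) ∧
      deriv (sepPotential₀ M a ω m Λ) rmax = 0 ∧
      ∀ r ∈ Ioi rmax, deriv (sepPotential₀ M a ω m Λ) r < 0 := by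
  have hM := hMa.pos
  have hrp0 := rPlus_pos' hMa
  have h7 : critPoly M a ω m Λ (7 * M) < 0 := critPoly_neg_of_seven_mul_le hMa hadm hΛ le_rfl
  have hc7 : c < 7 * M := by
    by_contra h
    linarith [critPoly_neg_of_seven_mul_le hMa hadm hΛ (not_lt.1 h)]
  obtain ⟨z, hz, hPz⟩ : ∃ z ∈ Ioo c (7 * M), critPoly M a ω m Λ z = 0 :=
    intermediate_value_Ioo' hc7.le (continuous_critPoly M a ω m Λ).continuousOn ⟨h7, hPc⟩
  refine ⟨z, hcp.trans_lt hz.1, hz.2, fun r hr ↦ ?_, ?_, fun r hr ↦ ?_⟩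
  · rw [deriv_sepPotential₀_pos_iff M a ω m Λ (hrp0.trans hr.1)]
    rcases le_or_gt r c with hrc | hrc
    · exact hPp.trans_lt (hmono ⟨le_rfl, hcp⟩ ⟨hr.1.le, hrc⟩ hr.1)
    · have := hanti hrc.le hz.1.le hr.2
      rwa [hPz] at this
  · exact (deriv_sepPotential₀_eq_zero_iff M a ω m Λ (hrp0.trans (hcp.trans_lt hz.1))).2 hPz
  · rw [deriv_sepPotential₀_neg_iff M a ω m Λ (hrp0.trans ((hcp.trans_lt hz.1).trans hr))]
    have := hanti hz.1.le ((hz.1.trans hr).le) hr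
    rwa [hPz] at this

/-- Case (c) of Lemma 6.3.1 from the turning-point data: if moreover `P(r₊) < 0`, there are
exactly two zeros `z₁ ∈ (r₊, c)`, `z₂ ∈ (c, 7M)` and `P < 0`, `> 0`, `< 0` on `(r₊, z₁)`,
`(z₁, z₂)`, `(z₂, ∞)`. DRSR arXiv:1402.7034, Lemma 6.3.1 (proof, case (c*)).
[cite: DafermosRodnianskiShlapentokhrothman2014, Lemma 6.3.1 (proof)] -/
private theorem caseC {c : ℝ} (hMa : IsSubextremal M a) (hadm : IsAdmissibleTriple a ω m Λ)
    (hΛ : 0 < Λ) (hcp : rPlus M a ≤ c)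
    (hmono : StrictMonoOn (critPoly M a ω m Λ) (Icc (rPlus M a) c))
    (hanti : StrictAntiOn (critPoly M a ω m Λ) (Ici c))
    (hPc : 0 < critPoly M a ω m Λ c) (hPp : critPoly M a ω m Λ (rPlus M a) < 0) :
    ∃ rmin rmax, rPlus M a < rmin ∧ rmin < rmax ∧ rmax < 7 * M ∧
      (∀ r ∈ Ioo (rPlus M a) rmin, deriv (sepPotential₀ M a ω m Λ) r < 0) ∧
      deriv (sepPotential₀ M a ω m Λ) rmin = 0 ∧
      (∀ r ∈ Ioo rmin rmax, 0 < deriv (sepPotential₀ M a ω m Λ) r) ∧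
      deriv (sepPotential₀ M a ω m Λ) rmax = 0 ∧
      ∀ r ∈ Ioi rmax, deriv (sepPotential₀ M a ω m Λ) r < 0 := by
  have hM := hMa.pos
  have hrp0 := rPlus_pos' hMa
  have h7 : critPoly M a ω m Λ (7 * M) < 0 := critPoly_neg_of_seven_mul_le hMa hadm hΛ le_rfl
  have hc7 : c < 7 * M := by
    by_contra h
    linarith [critPoly_neg_of_seven_mul_le hMa hadm hΛ (not_lt.1 h)]
  have hcp' : rPlus M a < c := lt_of_le_of_ne hcp fun h ↦ by rw [h] at hPp; linarith
  obtain ⟨z₁, hz₁, hPz₁⟩ : ∃ z ∈ Ioo (rPlus M a) c, critPoly M a ω m Λ z = 0 :=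
    intermediate_value_Ioo hcp (continuous_critPoly M a ω m Λ).continuousOn ⟨hPp, hPc⟩
  obtain ⟨z₂, hz₂, hPz₂⟩ : ∃ z ∈ Ioo c (7 * M), critPoly M a ω m Λ z = 0 :=
    intermediate_value_Ioo' hc7.le (continuous_critPoly M a ω m Λ).continuousOn ⟨h7, hPc⟩
  refine ⟨z₁, z₂, hz₁.1, hz₁.2.trans hz₂.1, hz₂.2, fun r hr ↦ ?_, ?_, fun r hr ↦ ?_, ?_,
    fun r hr ↦ ?_⟩
  · rw [deriv_sepPotential₀_neg_iff M a ω m Λ (hrp0.trans hr.1)]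
    have := hmono ⟨hr.1.le, (hr.2.trans hz₁.2).le⟩ ⟨hz₁.1.le, hz₁.2.le⟩ hr.2
    rwa [hPz₁] at this
  · exact (deriv_sepPotential₀_eq_zero_iff M a ω m Λ (hrp0.trans hz₁.1)).2 hPz₁
  · rw [deriv_sepPotential₀_pos_iff M a ω m Λ (hrp0.trans (hz₁.1.trans hr.1))]
    rcases le_or_gt r c with hrc | hrc
    · have := hmono ⟨hz₁.1.le, hz₁.2.le⟩ ⟨(hz₁.1.trans hr.1).le, hrc⟩ hr.1
      rwa [hPz₁] at this
    · have := hanti hrc.le hz₂.1.le hr.2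
      rwa [hPz₂] at this
  · exact (deriv_sepPotential₀_eq_zero_iff M a ω m Λ (hrp0.trans (hcp.trans_lt hz₂.1))).2 hPz₂
  · rw [deriv_sepPotential₀_neg_iff M a ω m Λ (hrp0.trans ((hcp.trans_lt hz₂.1).trans hr))]
    have := hanti hz₂.1.le ((hz₂.1.trans hr).le) hr
    rwa [hPz₂] at this

/-- The turning point packaged as monotonicity of `P`: `P` is strictly increasing on `[r₊, c]`
and strictly decreasing on `[c, ∞)` for some `c ≥ r₊`. DRSR arXiv:1402.7034, Lemma 6.3.1
(proof). [cite: DafermosRodnianskiShlapentokhrothman2014, Lemma 6.3.1 (proof)] -/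
private theorem turning (hMa : IsSubextremal M a) (hadm : IsAdmissibleTriple a ω m Λ)
    (hΛ : 0 < Λ) :
    ∃ c, rPlus M a ≤ c ∧ StrictMonoOn (critPoly M a ω m Λ) (Icc (rPlus M a) c) ∧
      StrictAntiOn (critPoly M a ω m Λ) (Ici c) := by
  obtain ⟨c, hcp, -, hpos, -, hneg⟩ := exists_critPoly_turningPoint (ω := ω) hMa hadm hΛ
  refine ⟨c, hcp, ?_, ?_⟩
  · exact strictMonoOn_of_deriv_pos (convex_Icc _ _)
      (continuous_critPoly M a ω m Λ).continuousOn fun x hx ↦ by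
        rw [interior_Icc] at hx
        rw [deriv_critPoly]
        exact hpos x ⟨hx.1.le, hx.2⟩
  · exact strictAntiOn_of_deriv_neg (convex_Ici _)
      (continuous_critPoly M a ω m Λ).continuousOn fun x hx ↦ by
        rw [interior_Ici] at hx
        rw [deriv_critPoly]
        exact hneg x hx

/-- **DRSR Lemma 6.3.1 (the critical points of `V₀`).** Let `|a| < M` and let `(ω, m, Λ)` be an
admissible frequency triple with `Λ > 0`. Then `V₀ : (r₊, ∞) → ℝ` is either
(a) strictly decreasing; or
(b) `dV₀/dr > 0` on `(r₊, r⁰_max)`, `dV₀/dr(r⁰_max) = 0`, `dV₀/dr < 0` on `(r⁰_max, ∞)` — a unique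
critical point, a global maximum (`sepPotential₀_isMaxOn_of_deriv_sign`); or
(c) `dV₀/dr < 0` on `(r₊, r⁰_min)`, `= 0` at `r⁰_min`, `> 0` on `(r⁰_min, r⁰_max)`, `= 0` at `r⁰_max`,
`< 0` on `(r⁰_max, ∞)` — exactly two critical points, a local minimum and a local maximum
(`sepPotential₀_isLocalMin_isLocalMax_of_deriv_sign`);
and in cases (b), (c) `r⁰_max < 7M` (the source's "`r⁰_max ≤ B` independently of the frequency
parameters", explicit). Printed for `0 ≤ a ≤ a₀ < M`; only `|a| < M` is needed. DRSR
arXiv:1402.7034, Lemma 6.3.1 (= Lemma 11.1.1 of Dafermos–Rodnianski arXiv:1010.5137, Proc. MG12).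
[cite: DafermosRodnianskiShlapentokhrothman2014, Lemma 6.3.1] -/
theorem sepPotential₀_trichotomy (hMa : IsSubextremal M a) (hadm : IsAdmissibleTriple a ω m Λ)
    (hΛ : 0 < Λ) :
    StrictAntiOn (sepPotential₀ M a ω m Λ) (Ioi (rPlus M a)) ∨
    (∃ rmax, rPlus M a < rmax ∧ rmax < 7 * M ∧
      (∀ r ∈ Ioo (rPlus M a) rmax, 0 < deriv (sepPotential₀ M a ω m Λ) r) ∧
      deriv (sepPotential₀ M a ω m Λ) rmax = 0 ∧
      ∀ r ∈ Ioi rmax, deriv (sepPotential₀ M a ω m Λ) r < 0) ∨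
    (∃ rmin rmax, rPlus M a < rmin ∧ rmin < rmax ∧ rmax < 7 * M ∧
      (∀ r ∈ Ioo (rPlus M a) rmin, deriv (sepPotential₀ M a ω m Λ) r < 0) ∧
      deriv (sepPotential₀ M a ω m Λ) rmin = 0 ∧
      (∀ r ∈ Ioo rmin rmax, 0 < deriv (sepPotential₀ M a ω m Λ) r) ∧
      deriv (sepPotential₀ M a ω m Λ) rmax = 0 ∧
      ∀ r ∈ Ioi rmax, deriv (sepPotential₀ M a ω m Λ) r < 0) := by
  have hrp0 := rPlus_pos' hMa
  obtain ⟨c, hcp, hmono, hanti⟩ := turning (ω := ω) hMa hadm hΛ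
  rcases le_or_gt (critPoly M a ω m Λ c) 0 with hPc | hPc
  · refine Or.inl (strictAntiOn_sepPotential₀_of_deriv_neg hMa hcp fun r hr hrc ↦ ?_)
    rw [deriv_sepPotential₀_neg_iff M a ω m Λ (hrp0.trans hr)]
    rcases lt_or_gt_of_ne hrc with h | h
    · exact (hmono ⟨le_of_lt hr, h.le⟩ ⟨hcp, le_rfl⟩ h).trans_le hPc
    · exact (hanti self_mem_Ici h.le h).trans_le hPc
  · refine Or.inr ?_
    rcases lt_or_ge (critPoly M a ω m Λ (rPlus M a)) 0 with hPp | hPp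
    · exact Or.inr (caseC hMa hadm hΛ hcp hmono hanti hPc hPp)
    · exact Or.inl (caseB hMa hadm hΛ hcp hmono hanti hPc hPp)

/-- **DRSR Lemma 6.3.1, the bound `r⁰_max ≤ B`, explicitly**: `dV₀/dr < 0` for all `r ≥ 7M`
(`|a| < M`, admissible triple, `Λ > 0`). [cite: DafermosRodnianskiShlapentokhrothman2014, Lemma 6.3.1] -/
theorem deriv_sepPotential₀_neg_of_seven_mul_le (hMa : IsSubextremal M a)
    (hadm : IsAdmissibleTriple a ω m Λ) (hΛ : 0 < Λ) {r : ℝ} (hr : 7 * M ≤ r) :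
    deriv (sepPotential₀ M a ω m Λ) r < 0 :=
  (deriv_sepPotential₀_neg_iff M a ω m Λ (by linarith [hMa.pos])).2
    (critPoly_neg_of_seven_mul_le hMa hadm hΛ hr)

/-- **Case (b) of Lemma 6.3.1 in words**: from the sign data, `V₀` is strictly increasing on
`(r₊, r⁰_max]`, strictly decreasing on `[r⁰_max, ∞)`, and `r⁰_max` is the global maximum of `V₀` on
`(r₊, ∞)` ("has a unique critical value `r⁰_max` which is a global maximum"). DRSR
arXiv:1402.7034, Lemma 6.3.1 (b). [cite: DafermosRodnianskiShlapentokhrothman2014, Lemma 6.3.1] -/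
theorem sepPotential₀_isMaxOn_of_deriv_sign (hMa : IsSubextremal M a) {rmax : ℝ}
    (hp : rPlus M a < rmax)
    (hpos : ∀ r ∈ Ioo (rPlus M a) rmax, 0 < deriv (sepPotential₀ M a ω m Λ) r)
    (hneg : ∀ r ∈ Ioi rmax, deriv (sepPotential₀ M a ω m Λ) r < 0) :
    StrictMonoOn (sepPotential₀ M a ω m Λ) (Ioc (rPlus M a) rmax) ∧
      StrictAntiOn (sepPotential₀ M a ω m Λ) (Ici rmax) ∧
      IsMaxOn (sepPotential₀ M a ω m Λ) (Ioi (rPlus M a)) rmax := by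
  have hr0 := rPlus_pos' hMa
  have hcont : ContinuousOn (sepPotential₀ M a ω m Λ) (Ioi (rPlus M a)) :=
    continuousOn_sepPotential₀ M a ω m Λ (Ioi_subset_Ioi hr0.le)
  have h1 : StrictMonoOn (sepPotential₀ M a ω m Λ) (Ioc (rPlus M a) rmax) :=
    strictMonoOn_of_deriv_pos (convex_Ioc _ _) (hcont.mono Ioc_subset_Ioi_self)
      (by rw [interior_Ioc]; exact hpos)
  have h2 : StrictAntiOn (sepPotential₀ M a ω m Λ) (Ici rmax) :=
    strictAntiOn_of_deriv_neg (convex_Ici _) (hcont.mono fun x hx ↦ hp.trans_le hx)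
      (by rw [interior_Ici]; exact hneg)
  refine ⟨h1, h2, isMaxOn_iff.2 fun r hr ↦ ?_⟩
  rcases lt_trichotomy r rmax with h | rfl | h
  · exact (h1 ⟨hr, h.le⟩ ⟨hp, le_rfl⟩ h).le
  · exact le_rfl
  · exact (h2 self_mem_Ici h.le h).le

/-- **Case (c) of Lemma 6.3.1 in words**: from the sign data, `V₀` is strictly decreasing on
`[r₊, r⁰_min]`, strictly increasing on `[r⁰_min, r⁰_max]`, strictly decreasing on `[r⁰_max, ∞)`;
`r⁰_min` is a local minimum and `r⁰_max` a local maximum ("exactly two critical values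
`r⁰_min < r⁰_max` which are a local minimum and maximum respectively"). DRSR arXiv:1402.7034,
Lemma 6.3.1 (c). [cite: DafermosRodnianskiShlapentokhrothman2014, Lemma 6.3.1] -/
theorem sepPotential₀_isLocalMin_isLocalMax_of_deriv_sign (hMa : IsSubextremal M a)
    {rmin rmax : ℝ} (hp : rPlus M a < rmin) (hlt : rmin < rmax)
    (hneg₁ : ∀ r ∈ Ioo (rPlus M a) rmin, deriv (sepPotential₀ M a ω m Λ) r < 0)
    (hpos : ∀ r ∈ Ioo rmin rmax, 0 < deriv (sepPotential₀ M a ω m Λ) r)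
    (hneg₂ : ∀ r ∈ Ioi rmax, deriv (sepPotential₀ M a ω m Λ) r < 0) :
    StrictAntiOn (sepPotential₀ M a ω m Λ) (Icc (rPlus M a) rmin) ∧
      StrictMonoOn (sepPotential₀ M a ω m Λ) (Icc rmin rmax) ∧
      StrictAntiOn (sepPotential₀ M a ω m Λ) (Ici rmax) ∧
      IsLocalMin (sepPotential₀ M a ω m Λ) rmin ∧ IsLocalMax (sepPotential₀ M a ω m Λ) rmax := by
  have hr0 := rPlus_pos' hMa
  have hcont : ContinuousOn (sepPotential₀ M a ω m Λ) (Ici (rPlus M a)) :=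
    continuousOn_sepPotential₀ M a ω m Λ fun x hx ↦ hr0.trans_le hx
  have h1 : StrictAntiOn (sepPotential₀ M a ω m Λ) (Icc (rPlus M a) rmin) :=
    strictAntiOn_of_deriv_neg (convex_Icc _ _) (hcont.mono Icc_subset_Ici_self)
      (by rw [interior_Icc]; exact hneg₁)
  have h2 : StrictMonoOn (sepPotential₀ M a ω m Λ) (Icc rmin rmax) :=
    strictMonoOn_of_deriv_pos (convex_Icc _ _) (hcont.mono fun x hx ↦ hp.le.trans hx.1)
      (by rw [interior_Icc]; exact hpos)
  have h3 : StrictAntiOn (sepPotential₀ M a ω m Λ) (Ici rmax) :=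
    strictAntiOn_of_deriv_neg (convex_Ici _) (hcont.mono fun x hx ↦ (hp.trans hlt).le.trans hx)
      (by rw [interior_Ici]; exact hneg₂)
  refine ⟨h1, h2, h3, ?_, ?_⟩
  · filter_upwards [Ioo_mem_nhds hp hlt] with x hx
    rcases le_or_gt rmin x with h | h
    · exact h2.monotoneOn ⟨le_rfl, hlt.le⟩ ⟨h, hx.2.le⟩ h
    · exact (h1 ⟨hx.1.le, h.le⟩ ⟨hp.le, le_rfl⟩ h).le
  · filter_upwards [Ioi_mem_nhds hlt] with x hx
    rcases le_or_gt x rmax with h | h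
    · exact h2.monotoneOn ⟨(le_of_lt hx), h⟩ ⟨hlt.le, le_rfl⟩ h
    · exact (h3 self_mem_Ici h.le h).le

/-- **DRSR Lemma 6.3.2, second clause**: in the notation of Lemma 6.3.1 (c),
`ω² > V₀(r⁰_min)`. Indeed `V₀` is strictly decreasing on `[r₊, r⁰_min]` (`dV₀/dr < 0` on the open
interval, continuity at the ends), so `V₀(r⁰_min) < V₀(r₊) = V(r₊) ≤ ω²` by the first clause
(`sepPotential_rPlus_le`, `V₁(r₊) = 0`). Requires `|a| < M`. DRSR arXiv:1402.7034, Lemma 6.3.2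
("In particular … `ω² > V₀(r⁰_min)`"). [cite: DafermosRodnianskiShlapentokhrothman2014, Lemma 6.3.2] -/
theorem sepPotential₀_lt_sq_of_deriv_neg (hMa : IsSubextremal M a) {rmin : ℝ}
    (hp : rPlus M a < rmin)
    (hneg : ∀ r ∈ Ioo (rPlus M a) rmin, deriv (sepPotential₀ M a ω m Λ) r < 0) :
    sepPotential₀ M a ω m Λ rmin < ω ^ 2 := by
  have hr0 := rPlus_pos' hMa
  have h : |a| ≤ M := le_of_lt hMa
  have hcont : ContinuousOn (sepPotential₀ M a ω m Λ) (Icc (rPlus M a) rmin) :=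
    continuousOn_sepPotential₀ M a ω m Λ fun x hx ↦ hr0.trans_le hx.1
  have h1 : StrictAntiOn (sepPotential₀ M a ω m Λ) (Icc (rPlus M a) rmin) :=
    strictAntiOn_of_deriv_neg (convex_Icc _ _) hcont (by rw [interior_Icc]; exact hneg)
  have h2 : sepPotential₀ M a ω m Λ rmin < sepPotential₀ M a ω m Λ (rPlus M a) :=
    h1 (left_mem_Icc.2 hp.le) (right_mem_Icc.2 hp.le) hp
  have h3 : sepPotential₀ M a ω m Λ (rPlus M a) = sepPotential M a ω m Λ (rPlus M a) := by
    rw [sepPotential, sepPotential₁_rPlus h, add_zero]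
  linarith [sepPotential_rPlus_le h hMa.pos ω m Λ]

/-! ### Lemma 6.4.1: second assertion and the `α`-variant -/

/-- **Lemma 6.4.1, second assertion (abstract form)**: if `dV₀/dr(r₊) > 0` (`|a| < M`,
admissible triple, `Λ > 0`) then case (b) of Lemma 6.3.1 holds — "`r⁰_min` does not exist and the
potential `V₀` has its unique critical point at `r⁰_max`" (`P(r₊) > 0` forces `P(c) > 0` at the
turning point). DRSR arXiv:1402.7034, Lemma 6.4.1 (the paragraph after (increaseHorizon)).
[cite: DafermosRodnianskiShlapentokhrothman2014, Lemma 6.4.1] -/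
theorem sepPotential₀_caseB_of_deriv_rPlus_pos (hMa : IsSubextremal M a)
    (hadm : IsAdmissibleTriple a ω m Λ) (hΛ : 0 < Λ)
    (hp : 0 < deriv (sepPotential₀ M a ω m Λ) (rPlus M a)) :
    ∃ rmax, rPlus M a < rmax ∧ rmax < 7 * M ∧
      (∀ r ∈ Ioo (rPlus M a) rmax, 0 < deriv (sepPotential₀ M a ω m Λ) r) ∧
      deriv (sepPotential₀ M a ω m Λ) rmax = 0 ∧
      ∀ r ∈ Ioi rmax, deriv (sepPotential₀ M a ω m Λ) r < 0 := by
  have hrp0 := rPlus_pos' hMa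
  have hPp : 0 < critPoly M a ω m Λ (rPlus M a) :=
    (deriv_sepPotential₀_pos_iff M a ω m Λ hrp0).1 hp
  obtain ⟨c, hcp, hmono, hanti⟩ := turning (ω := ω) hMa hadm hΛ
  have hPc : 0 < critPoly M a ω m Λ c :=
    hPp.trans_le (hmono.monotoneOn ⟨le_rfl, hcp⟩ ⟨hcp, le_rfl⟩ hcp)
  exact caseB hMa hadm hΛ hcp hmono hanti hPc hPp.le

/-- **DRSR Lemma 6.4.1, the horizon bound under the weaker assumption (withAlpha), explicitly.**
For `0 < M`, `0 ≤ a < M`, an admissible triple, `α ≥ 0` and `mω ≤ am²/(2Mr₊) + αΛ`: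
`dV₀/dr(r₊) ≥ (4(r₊ − M)(Mr₊ − a²) − 4aMα(3r₊² − a²)) Λ/(r₊² + a²)³` — the printed chain
`(r₊² + a²)³ dV₀/dr(r₊) ≥ 4(r₊ − M)(ΛMr₊ − a²m²)` acquires the extra term `4aM(a² − 3r₊²)αΛ` when
the upper bound for `mω` is substituted (for `mω ≤ 0` the bound of the `α = 0` case,
`le_deriv_sepPotential₀_rPlus`, is only improved). The source: "for all `α > 0` sufficiently
small, the same statement holds under the weaker assumption `mω ≤ am²/(2Mr₊) + αΛ`".
[cite: DafermosRodnianskiShlapentokhrothman2014, Lemma 6.4.1] -/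
theorem le_deriv_sepPotential₀_rPlus_alpha (hM : 0 < M) (ha0 : 0 ≤ a) (haM : a < M)
    (hadm : IsAdmissibleTriple a ω m Λ) {α : ℝ} (hα : 0 ≤ α)
    (hsr : m * ω ≤ a * (m : ℝ) ^ 2 / (2 * M * rPlus M a) + α * Λ) :
    (4 * (rPlus M a - M) * (M * rPlus M a - a ^ 2) -
        4 * a * M * α * (3 * rPlus M a ^ 2 - a ^ 2)) * Λ / (rPlus M a ^ 2 + a ^ 2) ^ 3 ≤
      deriv (sepPotential₀ M a ω m Λ) (rPlus M a) := by
  have h : |a| ≤ M := by rw [abs_of_nonneg ha0]; exact haM.le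
  have hr : 0 < rPlus M a := by
    unfold rPlus; linarith [Real.sqrt_nonneg (M ^ 2 - a ^ 2)]
  have hrM : M < rPlus M a := by
    have : 0 < √(M ^ 2 - a ^ 2) := Real.sqrt_pos.2 (by nlinarith)
    unfold rPlus; linarith
  set r := rPlus M a with hr_def
  have hA := rPlus_sq_add_sq h
  rw [← hr_def] at hA
  rw [(hasDerivAt_sepPotential₀_rPlus h hM ω m Λ).deriv, ← hr_def]
  have hA3 : 0 < (r ^ 2 + a ^ 2) ^ 3 := by positivity
  rw [div_le_div_iff_of_pos_right hA3]
  have hΛ := hadm.nonneg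
  have hm2 := hadm.sq_le
  have hneg : -3 * r ^ 2 + a ^ 2 < 0 := by nlinarith
  have hextra : 0 ≤ 4 * a * M * α * (3 * r ^ 2 - a ^ 2) * Λ := by
    have : 0 ≤ 3 * r ^ 2 - a ^ 2 := by linarith
    positivity
  have hstep2 : 4 * (r - M) * (M * r - a ^ 2) * Λ ≤
      4 * (r - M) * (Λ * M * r - a ^ 2 * (m : ℝ) ^ 2) := by
    have : 0 ≤ 4 * (r - M) := by linarith
    nlinarith [mul_le_mul_of_nonneg_left hm2 (sq_nonneg a)]
  rcases le_or_gt ((m : ℝ) * ω) 0 with hmω | hmω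
  · -- `mω ≤ 0`: the first term is nonnegative, the `α`-correction only helps
    have h1 : 0 ≤ 4 * m * a * M * ω * (-3 * r ^ 2 + a ^ 2) := by
      have : 4 * m * a * M * ω * (-3 * r ^ 2 + a ^ 2) =
          (4 * a * M) * ((m : ℝ) * ω) * (-3 * r ^ 2 + a ^ 2) := by ring
      rw [this]
      exact mul_nonneg_of_nonpos_of_nonpos
        (mul_nonpos_of_nonneg_of_nonpos (by positivity) hmω) hneg.le
    have e : 2 * (r ^ 2 + a ^ 2) * (r - M) * Λ = 4 * M * r * (r - M) * Λ := by rw [hA]; ring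
    have p1 : 0 ≤ r * (a ^ 2 * (m : ℝ) ^ 2) := mul_nonneg hr.le (by positivity)
    have p2 : 0 ≤ (r - M) * (a ^ 2 * (m : ℝ) ^ 2) := mul_nonneg (by linarith) (by positivity)
    nlinarith [e, h1, p1, p2, hextra]
  · -- `0 < mω ≤ am²/(2Mr₊) + αΛ`: substitute the upper bound (its coefficient is nonpositive)
    have hcoef : 4 * a * M * (-3 * r ^ 2 + a ^ 2) ≤ 0 :=
      mul_nonpos_of_nonneg_of_nonpos (by positivity) hneg.le
    have h1 : 4 * a * M * (-3 * r ^ 2 + a ^ 2) * (a * (m : ℝ) ^ 2 / (2 * M * r) + α * Λ) ≤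
        4 * a * M * (-3 * r ^ 2 + a ^ 2) * ((m : ℝ) * ω) :=
      mul_le_mul_of_nonpos_left hsr hcoef
    have h2 : 4 * a * M * (-3 * r ^ 2 + a ^ 2) * (a * (m : ℝ) ^ 2 / (2 * M * r) + α * Λ) =
        2 * a ^ 2 * (m : ℝ) ^ 2 * (-3 * r ^ 2 + a ^ 2) / r -
          4 * a * M * α * (3 * r ^ 2 - a ^ 2) * Λ := by
      field_simp
      ring
    have h3 : 2 * a ^ 2 * (m : ℝ) ^ 2 * (-3 * r ^ 2 + a ^ 2) / r + 4 * r * a ^ 2 * (m : ℝ) ^ 2 +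
        2 * (r ^ 2 + a ^ 2) * (r - M) * Λ = 4 * (r - M) * (Λ * M * r - a ^ 2 * (m : ℝ) ^ 2) := by
      field_simp
      linear_combination (2 * a ^ 2 * (m : ℝ) ^ 2 + 2 * r * (r - M) * Λ) * hA
    have h4 : 4 * m * a * M * ω * (-3 * r ^ 2 + a ^ 2) =
        4 * a * M * (-3 * r ^ 2 + a ^ 2) * ((m : ℝ) * ω) := by ring
    rw [h4]
    nlinarith [h1, h2, h3, hstep2]

/-- **DRSR Lemma 6.4.1, second assertion**, with the `α`-variant and explicit smallness: for
`0 < M`, `0 ≤ a < M`, an admissible triple with `Λ > 0`, `α ≥ 0` with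
`4aMα(3r₊² − a²) < 4(r₊ − M)(Mr₊ − a²)` (true for `α = 0`, `deriv_sepPotential₀_rPlus_const_pos`)
and `mω ≤ am²/(2Mr₊) + αΛ` (a range containing the superradiant frequencies), `V₀` is in case (b)
of Lemma 6.3.1: `dV₀/dr > 0` on `(r₊, r⁰_max)`, `= 0` at `r⁰_max < 7M`, `< 0` beyond — "`r⁰_min` does
not exist and the potential `V₀` has its unique critical point at `r⁰_max`". As in loc. cit. the
statement uses the reduction to `a ≥ 0` (§4.2). [cite: DafermosRodnianskiShlapentokhrothman2014, Lemma 6.4.1] -/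
theorem sepPotential₀_caseB_of_superradiant (hM : 0 < M) (ha0 : 0 ≤ a) (haM : a < M)
    (hadm : IsAdmissibleTriple a ω m Λ) (hΛ : 0 < Λ) {α : ℝ} (hα : 0 ≤ α)
    (hαs : 4 * a * M * α * (3 * rPlus M a ^ 2 - a ^ 2) <
      4 * (rPlus M a - M) * (M * rPlus M a - a ^ 2))
    (hsr : m * ω ≤ a * (m : ℝ) ^ 2 / (2 * M * rPlus M a) + α * Λ) :
    ∃ rmax, rPlus M a < rmax ∧ rmax < 7 * M ∧
      (∀ r ∈ Ioo (rPlus M a) rmax, 0 < deriv (sepPotential₀ M a ω m Λ) r) ∧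
      deriv (sepPotential₀ M a ω m Λ) rmax = 0 ∧
      ∀ r ∈ Ioi rmax, deriv (sepPotential₀ M a ω m Λ) r < 0 := by
  have hMa : IsSubextremal M a := by
    show |a| < M
    rwa [abs_of_nonneg ha0]
  have hr : 0 < rPlus M a := rPlus_pos' hMa
  refine sepPotential₀_caseB_of_deriv_rPlus_pos hMa hadm hΛ (lt_of_lt_of_le ?_
    (le_deriv_sepPotential₀_rPlus_alpha hM ha0 haM hadm hα hsr))
  have hA3 : 0 < (rPlus M a ^ 2 + a ^ 2) ^ 3 := by positivity
  exact div_pos (mul_pos (by linarith) hΛ) hA3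

/-! ### Lemma 6.5.1: `r⁰_max > (1 + √2)M` -/

/-- **DRSR Lemma 6.5.1, the computation**: for `|a| < M`, `Λ > 0` and
`12M²|amω| ≤ (M² − a²)Λ` (i.e. `|σ| = |amω|/Λ ≤ c` with the explicit `c = (1 − a²/M²)/12`,
uniform in `a ≤ a₀ < M`), `dV₀/dr > 0` at `r = (1 + √2)M`. As printed:
`Λ⁻¹(r² + a²)³ dV₀/dr|_{r=(1+√2)M} = O(c) − 2(2M(a² − M²) + √2 M(a² − M²))`, using
`(1 + √2)² = 3 + 2√2`, `(1 + √2)³ = 7 + 5√2`; here `O(c)` is the bound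
`4maMω(a² − 3r²) ≥ −12(3 + 2√2)M³|amω|` while the printed hypotheses `m² ≤ cΛ`, `c⁻¹ ≤ Λ` are not
needed (the term `4ra²m² ≥ 0`). [cite: DafermosRodnianskiShlapentokhrothman2014, Lemma 6.5.1] -/
theorem deriv_sepPotential₀_pos_trappingRadius (hMa : IsSubextremal M a) (hΛ : 0 < Λ)
    (hσ : 12 * M ^ 2 * |a * m * ω| ≤ (M ^ 2 - a ^ 2) * Λ) :
    0 < deriv (sepPotential₀ M a ω m Λ) ((1 + √2) * M) := by
  have hM := hMa.pos
  have ha2 : a ^ 2 < M ^ 2 := sq_lt_sq' (abs_lt.1 hMa).1 (abs_lt.1 hMa).2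
  set s := √2 with hs_def
  have hs2 : s ^ 2 = 2 := Real.sq_sqrt (by norm_num)
  have hs0 : 0 ≤ s := Real.sqrt_nonneg 2
  set r₁ := (1 + s) * M with hr₁_def
  have hr₁ : 0 < r₁ := by positivity
  have hr₁M : M ≤ r₁ := by rw [hr₁_def]; nlinarith
  rw [deriv_sepPotential₀_pos_iff M a ω m Λ hr₁]
  have hE : r₁ ^ 3 + a ^ 2 * r₁ - 3 * M * r₁ ^ 2 + M * a ^ 2 =
      (2 + s) * M * (a ^ 2 - M ^ 2) := by
    rw [hr₁_def]; linear_combination (M ^ 3 * s) * hs2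
  have hr₁sq : r₁ ^ 2 = (3 + 2 * s) * M ^ 2 := by
    rw [hr₁_def]; linear_combination (M ^ 2) * hs2
  have hX : 0 ≤ 3 * r₁ ^ 2 - a ^ 2 := by nlinarith
  have T1 : -(12 * M * ((3 + 2 * s) * M ^ 2)) * |a * m * ω| ≤
      4 * m * a * M * ω * (-3 * r₁ ^ 2 + a ^ 2) :=
    calc -(12 * M * ((3 + 2 * s) * M ^ 2)) * |a * m * ω|
        = -(4 * M * (3 * r₁ ^ 2)) * |a * m * ω| := by rw [hr₁sq]; ring
      _ ≤ -(4 * M * (3 * r₁ ^ 2 - a ^ 2)) * |a * m * ω| := by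
          have : 0 ≤ 4 * M * a ^ 2 * |a * m * ω| := by positivity
          nlinarith
      _ ≤ -(4 * M * (3 * r₁ ^ 2 - a ^ 2)) * (a * m * ω) := by
          have h4 : 0 ≤ 4 * M * (3 * r₁ ^ 2 - a ^ 2) := by positivity
          nlinarith [le_abs_self (a * m * ω)]
      _ = 4 * m * a * M * ω * (-3 * r₁ ^ 2 + a ^ 2) := by ring
  have T2 : 0 ≤ 4 * r₁ * a ^ 2 * (m : ℝ) ^ 2 := by positivity
  have hσ' := mul_le_mul_of_nonneg_left hσ (show 0 ≤ (3 + 2 * s) * M by positivity)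
  have hgap : 0 < M * ((M ^ 2 - a ^ 2) * Λ) := mul_pos hM (mul_pos (by linarith) hΛ)
  unfold critPoly
  rw [hE]
  nlinarith [T1, T2, hσ', hgap]

/-- Under the smallness hypothesis of Lemma 6.5.1, case (a) of Lemma 6.3.1 is excluded: `V₀` is
not strictly decreasing on `(r₊, ∞)` (an antitone function has `deriv ≤ 0`, but
`dV₀/dr((1 + √2)M) > 0` and `(1 + √2)M > 2M ≥ r₊`). DRSR arXiv:1402.7034, Lemma 6.5.1 (proof:
"since `r⁰_max` is the final critical point of `V₀` …"). [cite: DafermosRodnianskiShlapentokhrothman2014, Lemma 6.5.1 (proof)] -/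
theorem not_strictAntiOn_sepPotential₀_of_small (hMa : IsSubextremal M a) (hΛ : 0 < Λ)
    (hσ : 12 * M ^ 2 * |a * m * ω| ≤ (M ^ 2 - a ^ 2) * Λ) :
    ¬ StrictAntiOn (sepPotential₀ M a ω m Λ) (Ioi (rPlus M a)) := by
  intro h
  have hM := hMa.pos
  have hs : 1 < √2 := by
    rw [show (1 : ℝ) = √1 from Real.sqrt_one.symm]
    exact Real.sqrt_lt_sqrt (by norm_num) (by norm_num)
  have hx : (1 + √2) * M ∈ Ioi (rPlus M a) := by
    rw [mem_Ioi]
    have := rPlus_le_two_mul' hM.le a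
    nlinarith
  have h1 := h.antitoneOn.derivWithin_nonpos (x := (1 + √2) * M)
  rw [derivWithin_of_isOpen isOpen_Ioi hx] at h1
  exact absurd (deriv_sepPotential₀_pos_trappingRadius hMa hΛ hσ) (not_lt.2 h1)

/-- **DRSR Lemma 6.5.1, pointwise form**: under `12M²|amω| ≤ (M² − a²)Λ` (`|a| < M`, `Λ > 0`),
every "final" critical point of `V₀` — a zero `rmax` of `dV₀/dr` beyond which `dV₀/dr < 0`, as
`r⁰_max` in cases (b), (c) of Lemma 6.3.1 — satisfies `rmax > (1 + √2)M`. DRSR arXiv:1402.7034,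
Lemma 6.5.1 and Remark 6.5.1 (`(1 + √2)M` is the trapping radius of axisymmetric null geodesics on
extreme Kerr). [cite: DafermosRodnianskiShlapentokhrothman2014, Lemma 6.5.1] -/
theorem trappingRadius_lt_of_deriv_sign (hMa : IsSubextremal M a) (hΛ : 0 < Λ)
    (hσ : 12 * M ^ 2 * |a * m * ω| ≤ (M ^ 2 - a ^ 2) * Λ) {rmax : ℝ}
    (h0 : deriv (sepPotential₀ M a ω m Λ) rmax = 0)
    (hneg : ∀ r ∈ Ioi rmax, deriv (sepPotential₀ M a ω m Λ) r < 0) :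
    (1 + √2) * M < rmax := by
  by_contra h
  have hpos := deriv_sepPotential₀_pos_trappingRadius hMa hΛ hσ
  rcases (not_lt.1 h).eq_or_lt with h' | h'
  · rw [h'] at h0
    exact absurd h0 hpos.ne'
  · exact absurd hpos (not_lt.2 (hneg _ h').le)

/-- **DRSR Lemma 6.5.1** (trapping occurs outside the ergoregion for small `|σ|`): for `|a| < M`,
an admissible triple with `Λ > 0` and `12M²|amω| ≤ (M² − a²)Λ`, the point `r⁰_max` of
Lemma 6.3.1 exists (case (a) is excluded) and `(1 + √2)M < r⁰_max < 7M`: there is `rmax` with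
`dV₀/dr(rmax) = 0`, `dV₀/dr < 0` on `(rmax, ∞)`, `(1 + √2)M < rmax < 7M`. The printed smallness
"`|σ| ≤ c`, `m² ≤ cΛ`, `c⁻¹ ≤ Λ`" is replaced by the explicit first condition alone.
[cite: DafermosRodnianskiShlapentokhrothman2014, Lemma 6.5.1] -/
theorem exists_rmax_gt_trappingRadius (hMa : IsSubextremal M a)
    (hadm : IsAdmissibleTriple a ω m Λ) (hΛ : 0 < Λ)
    (hσ : 12 * M ^ 2 * |a * m * ω| ≤ (M ^ 2 - a ^ 2) * Λ) :
    ∃ rmax, (1 + √2) * M < rmax ∧ rmax < 7 * M ∧ deriv (sepPotential₀ M a ω m Λ) rmax = 0 ∧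
      ∀ r ∈ Ioi rmax, deriv (sepPotential₀ M a ω m Λ) r < 0 := by
  rcases sepPotential₀_trichotomy (ω := ω) hMa hadm hΛ with h | ⟨rmax, -, h7, -, h0, hneg⟩ |
    ⟨-, rmax, -, -, h7, -, -, -, h0, hneg⟩
  · exact absurd h (not_strictAntiOn_sepPotential₀_of_small hMa hΛ hσ)
  · exact ⟨rmax, trappingRadius_lt_of_deriv_sign hMa hΛ hσ h0 hneg, h7, h0, hneg⟩
  · exact ⟨rmax, trappingRadius_lt_of_deriv_sign hMa hΛ hσ h0 hneg, h7, h0, hneg⟩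

/-! ### Lemma 6.4.2: superradiant frequencies are not trapped -/

/-- Case 2 of the proof of Lemma 6.4.2 at the explicit radius `r̃ = 4M`: for `0 < M`,
`0 ≤ a ≤ M`, `m² ≤ Λ` and `mω ≥ 0`, `V₀(4M) ≥ 8Λ/(289M²)` (drop `4Mramω ≥ 0`, use `a²m² ≤ a²Λ`,
`Δ(4M) = 8M² + a²`, `(16M² + a²)² ≤ (17M²)²`). The source: "`V₀(r) − ω² ≥ Λ/r² + O(Λ/r³) − εΛ` as
`r → ∞` … let `r̃` be sufficiently large". [cite: DafermosRodnianskiShlapentokhrothman2014, Lemma 6.4.2 (proof)] -/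
theorem sepPotential₀_four_mul_ge (hM : 0 < M) (ha0 : 0 ≤ a) (haM : a ≤ M)
    (hq : (m : ℝ) ^ 2 ≤ Λ) (hp : 0 ≤ (m : ℝ) * ω) :
    8 * Λ / (289 * M ^ 2) ≤ sepPotential₀ M a ω m Λ (4 * M) := by
  have hΛ : 0 ≤ Λ := (sq_nonneg _).trans hq
  have ha2 : a ^ 2 ≤ M ^ 2 := by nlinarith
  unfold sepPotential₀ delta
  rw [div_le_div_iff₀ (by positivity) (by positivity)]
  have h1 : 0 ≤ 4 * M * (4 * M) * a * m * ω := by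
    have : 4 * M * (4 * M) * a * m * ω = (16 * M ^ 2 * a) * ((m : ℝ) * ω) := by ring
    rw [this]; positivity
  have h2 : ((4 * M) ^ 2 + a ^ 2) ^ 2 ≤ (17 * M ^ 2) ^ 2 := by nlinarith
  have e1 : 0 ≤ (4 * M * (4 * M) * a * m * ω) * (289 * M ^ 2) := mul_nonneg h1 (by positivity)
  have e2 : 0 ≤ a ^ 2 * (Λ - (m : ℝ) ^ 2) * (289 * M ^ 2) := by
    have := sub_nonneg.2 hq; positivity
  have e3 : 0 ≤ Λ * ((17 * M ^ 2) ^ 2 - ((4 * M) ^ 2 + a ^ 2) ^ 2) :=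
    mul_nonneg hΛ (sub_nonneg.2 h2)
  nlinarith [e1, e2, e3]

/-- A Lipschitz bound for the cubic `P` on `[M, 3M]`: `P(y) ≥ P(x) − 100M²Λ(y − x)` for
`M ≤ x ≤ y ≤ 3M` (`a² ≤ M²`, `Λ ≥ 2|amω|`, `Λ ≥ m²`), from
`P(y) − P(x) = (y − x)(−2Λ(y² + xy + x²) + (6ΛM − 12Mamω)(x + y) + 4a²m² − 2Λa²)`. Used for case 1
of Lemma 6.4.2 ("combining this with Lemma 6.4.1 easily shows `V₀(r₊ + δ) − ω² ≥ bΛ`").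
[cite: DafermosRodnianskiShlapentokhrothman2014, Lemma 6.4.2 (proof)] -/
theorem critPoly_sub_ge (hM : 0 < M) (ha2 : a ^ 2 ≤ M ^ 2) (hap : 2 * |a * m * ω| ≤ Λ)
    (hq : (m : ℝ) ^ 2 ≤ Λ) {x y : ℝ} (hx : M ≤ x) (hxy : x ≤ y) (hy : y ≤ 3 * M) :
    critPoly M a ω m Λ x - 100 * M ^ 2 * Λ * (y - x) ≤ critPoly M a ω m Λ y := by
  have hΛ : 0 ≤ Λ := (sq_nonneg _).trans hq
  have hM2Λ : 0 ≤ M ^ 2 * Λ := by positivity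
  set Q := -2 * Λ * (y ^ 2 + x * y + x ^ 2) + (6 * Λ * M - 12 * M * (a * m * ω)) * (x + y) +
    (4 * a ^ 2 * (m : ℝ) ^ 2 - 2 * Λ * a ^ 2) with hQ
  have key : critPoly M a ω m Λ y - critPoly M a ω m Λ x = (y - x) * Q := by
    simp only [critPoly, hQ]; ring
  have t1 : -2 * Λ * (y ^ 2 + x * y + x ^ 2) ≥ -2 * Λ * (27 * M ^ 2) := by
    have h27 : y ^ 2 + x * y + x ^ 2 ≤ 27 * M ^ 2 := by nlinarith
    nlinarith [mul_le_mul_of_nonneg_left h27 hΛ]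
  have t2 : (6 * Λ * M - 12 * M * (a * m * ω)) * (x + y) ≥ -(6 * M * Λ) * (6 * M) := by
    have hxy0 : 0 ≤ x + y := by linarith
    have hxy6 : x + y ≤ 6 * M := by linarith
    have h1 : -(6 * M * Λ) ≤ 6 * Λ * M - 12 * M * (a * m * ω) := by
      nlinarith [le_abs_self (a * m * ω)]
    have h2 : -(6 * M * Λ) * (x + y) ≤ (6 * Λ * M - 12 * M * (a * m * ω)) * (x + y) :=
      mul_le_mul_of_nonneg_right h1 hxy0
    have h3 : 6 * M * Λ * (x + y) ≤ 6 * M * Λ * (6 * M) :=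
      mul_le_mul_of_nonneg_left hxy6 (by positivity)
    linarith
  have t3 : 4 * a ^ 2 * (m : ℝ) ^ 2 - 2 * Λ * a ^ 2 ≥ -(2 * Λ * M ^ 2) := by
    nlinarith [mul_le_mul_of_nonneg_left ha2 hΛ, sq_nonneg a, sq_nonneg (m : ℝ)]
  have hQb : -(100 * M ^ 2 * Λ) ≤ Q := by rw [hQ]; linarith
  have := mul_le_mul_of_nonneg_left hQb (sub_nonneg.2 hxy)
  linarith

/-- `V₀(r₊) = ω² − (2Mr₊ω − am)²/(4M²r₊²)` (`|a| ≤ M`, `0 < M`): Lemma 6.3.2's identity for `V₀`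
(`V₁(r₊) = 0`); the source writes the subtracted square as `(ω − am/(2Mr₊))²`. Case 1 of the proof
of Lemma 6.4.2. [cite: DafermosRodnianskiShlapentokhrothman2014, Lemma 6.4.2 (proof)] -/
theorem sepPotential₀_rPlus_eq (h : |a| ≤ M) (hM : 0 < M) (ω : ℝ) (m : ℤ) (Λ : ℝ) :
    sepPotential₀ M a ω m Λ (rPlus M a) =
      ω ^ 2 - (2 * M * rPlus M a * ω - a * m) ^ 2 / (4 * M ^ 2 * rPlus M a ^ 2) := by
  have h1 := omega_sq_sub_sepPotential_rPlus h hM ω m Λ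
  have h2 : sepPotential₀ M a ω m Λ (rPlus M a) = sepPotential M a ω m Λ (rPlus M a) := by
    rw [sepPotential, sepPotential₁_rPlus h, add_zero]
  linarith

/-- **Case 1 of Lemma 6.4.2** (near the threshold `ω = ω₊m`), explicit. Let `0 < M`, `0 ≤ a < M`,
an admissible triple with `mω ≤ am²/(2Mr₊)`, `B₀ = 4(r₊ − M)(Mr₊ − a²)`, `0 < δ ≤ M` with
`200M²δ ≤ B₀`, and suppose `(2Mr₊ω − am)²/(4M²r₊²) ≤ ε₁Λ` with `ε₁ = δB₀/(4000M⁶)`. Then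
`V₀(r₊ + δ) − ω² ≥ ε₁Λ`: `P ≥ B₀Λ − 100M²Λδ ≥ B₀Λ/2` on `[r₊, r₊ + δ]` (Lemma 6.4.1 and
`critPoly_sub_ge`), so `dV₀/dr ≥ B₀Λ/(2000M⁶)` there and `V₀(r₊ + δ) ≥ V₀(r₊) + 2ε₁Λ`
(mean value inequality), while `V₀(r₊) = ω² − (2Mr₊ω − am)²/(4M²r₊²) ≥ ω² − ε₁Λ`.
[cite: DafermosRodnianskiShlapentokhrothman2014, Lemma 6.4.2 (proof)] -/
private theorem notTrapped_case1 (hM : 0 < M) (ha0 : 0 ≤ a) (haM : a < M)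
    (hadm : IsAdmissibleTriple a ω m Λ) (hsr : m * ω ≤ a * (m : ℝ) ^ 2 / (2 * M * rPlus M a))
    {δ : ℝ} (hδ : 0 < δ) (hδM : δ ≤ M)
    (hδB : 200 * M ^ 2 * δ ≤ 4 * (rPlus M a - M) * (M * rPlus M a - a ^ 2))
    (hD : (2 * M * rPlus M a * ω - a * m) ^ 2 / (4 * M ^ 2 * rPlus M a ^ 2) ≤
      δ * (4 * (rPlus M a - M) * (M * rPlus M a - a ^ 2)) / (4000 * M ^ 6) * Λ) :
    δ * (4 * (rPlus M a - M) * (M * rPlus M a - a ^ 2)) / (4000 * M ^ 6) * Λ ≤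
      sepPotential₀ M a ω m Λ (rPlus M a + δ) - ω ^ 2 := by
  have h : |a| ≤ M := by rw [abs_of_nonneg ha0]; exact haM.le
  have hMa : IsSubextremal M a := show |a| < M by rwa [abs_of_nonneg ha0]
  have hrM : M < rPlus M a := M_lt_rPlus' hMa
  have hr2 : rPlus M a ≤ 2 * M := rPlus_le_two_mul' hM.le a
  set r := rPlus M a with hr_def
  have hr0 : 0 < r := hM.trans hrM
  set B₀ := 4 * (r - M) * (M * r - a ^ 2) with hB₀_def
  have hB₀ : 0 < B₀ := mul_pos (mul_pos (by norm_num) (by linarith)) (by nlinarith)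
  have hΛ := hadm.nonneg
  have ha2 : a ^ 2 ≤ M ^ 2 := by nlinarith
  -- Step 1: `P(r₊) ≥ B₀ Λ` (Lemma 6.4.1)
  have hA3 : 0 < (r ^ 2 + a ^ 2) ^ 3 := by positivity
  have hPr : B₀ * Λ ≤ critPoly M a ω m Λ r := by
    have h1 := le_deriv_sepPotential₀_rPlus hM ha0 haM hadm hsr
    rw [← hr_def, deriv_sepPotential₀_eq M a ω m Λ (by positivity),
      div_le_div_iff_of_pos_right hA3] at h1
    simpa [hB₀_def] using h1
  -- Step 2: `P ≥ B₀Λ/2` on `[r₊, r₊ + δ]`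
  have hPx : ∀ x ∈ Icc r (r + δ), B₀ * Λ / 2 ≤ critPoly M a ω m Λ x := by
    intro x hx
    have h1 := critPoly_sub_ge (ω := ω) hM ha2 hadm.2 hadm.sq_le hrM.le hx.1
      (by linarith [hx.2])
    have h2 : 100 * M ^ 2 * Λ * (x - r) ≤ 100 * M ^ 2 * Λ * δ :=
      mul_le_mul_of_nonneg_left (by linarith [hx.2]) (by positivity)
    have h3 : 100 * M ^ 2 * δ * Λ ≤ B₀ / 2 * Λ := mul_le_mul_of_nonneg_right (by linarith) hΛ
    linarith
  -- Step 3: `dV₀/dr ≥ B₀Λ/(2000 M⁶)` on `(r₊, r₊ + δ)`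
  have hderiv : ∀ x ∈ interior (Icc r (r + δ)),
      B₀ * Λ / (2000 * M ^ 6) ≤ deriv (sepPotential₀ M a ω m Λ) x := by
    rw [interior_Icc]
    intro x hx
    have hx0 : 0 < x := hr0.trans hx.1
    have hbd : (x ^ 2 + a ^ 2) ^ 3 ≤ 1000 * M ^ 6 := by
      have h1 : x ^ 2 + a ^ 2 ≤ 10 * M ^ 2 := by nlinarith [hx.1, hx.2]
      have h0 : 0 ≤ x ^ 2 + a ^ 2 := by positivity
      calc (x ^ 2 + a ^ 2) ^ 3 ≤ (10 * M ^ 2) ^ 3 := pow_le_pow_left₀ h0 h1 3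
        _ = 1000 * M ^ 6 := by ring
    rw [deriv_sepPotential₀_eq M a ω m Λ (by positivity)]
    calc B₀ * Λ / (2000 * M ^ 6) = (B₀ * Λ / 2) / (1000 * M ^ 6) := by ring
      _ ≤ (B₀ * Λ / 2) / (x ^ 2 + a ^ 2) ^ 3 :=
          div_le_div_of_nonneg_left (by positivity) (by positivity) hbd
      _ ≤ critPoly M a ω m Λ x / (x ^ 2 + a ^ 2) ^ 3 :=
          div_le_div_of_nonneg_right (hPx x ⟨hx.1.le, hx.2.le⟩) (by positivity)
  -- Step 4: the mean value inequality on `[r₊, r₊ + δ]`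
  have hcont : ContinuousOn (sepPotential₀ M a ω m Λ) (Icc r (r + δ)) :=
    continuousOn_sepPotential₀ M a ω m Λ fun x hx ↦ hr0.trans_le hx.1
  have hdiff : DifferentiableOn ℝ (sepPotential₀ M a ω m Λ) (interior (Icc r (r + δ))) := by
    rw [interior_Icc]
    intro x hx
    exact (hasDerivAt_sepPotential₀ M a ω m Λ (r := x)
      (by have := hr0.trans hx.1; positivity)).differentiableAt.differentiableWithinAt
  have hmvt := (convex_Icc r (r + δ)).mul_sub_le_image_sub_of_le_deriv hcont hdiff hderiv r
    (left_mem_Icc.2 (by linarith)) (r + δ) (right_mem_Icc.2 (by linarith)) (by linarith)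
  -- Step 5: `V₀(r₊) = ω² − D`
  have hV₀r := sepPotential₀_rPlus_eq h hM ω m Λ
  rw [← hr_def] at hV₀r
  have e : B₀ * Λ / (2000 * M ^ 6) * (r + δ - r) = 2 * (δ * B₀ / (4000 * M ^ 6) * Λ) := by
    field_simp; ring
  rw [e] at hmvt
  linarith

/-- **Case 2 of Lemma 6.4.2** (`ω²` small), explicit: if `ω² ≤ 4Λ/(289M²)` (and `mω > 0`,
`0 ≤ a < M`, admissible) then `V₀(4M) − ω² ≥ 4Λ/(289M²)` (`sepPotential₀_four_mul_ge`).
[cite: DafermosRodnianskiShlapentokhrothman2014, Lemma 6.4.2 (proof)] -/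
private theorem notTrapped_case2 (hM : 0 < M) (ha0 : 0 ≤ a) (haM : a < M)
    (hadm : IsAdmissibleTriple a ω m Λ) (hpos : 0 < (m : ℝ) * ω)
    (hω : ω ^ 2 ≤ 4 / (289 * M ^ 2) * Λ) :
    4 / (289 * M ^ 2) * Λ ≤ sepPotential₀ M a ω m Λ (4 * M) - ω ^ 2 := by
  have h1 := sepPotential₀_four_mul_ge (ω := ω) hM ha0 haM.le hadm.sq_le hpos.le
  have e : 8 * Λ / (289 * M ^ 2) = 2 * (4 / (289 * M ^ 2) * Λ) := by ring
  linarith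

/-- **The identity of case 3 of Lemma 6.4.2**: at a point `r₀` with `2Mωr₀ = am` (i.e.
`r₀ = am/(2Mω)`), `V₀(r₀) − ω² = Δ(r₀)(Λ − ω²(r₀² + 2Mr₀ + a²))/(r₀² + a²)²`; the source writes the
bracket as `Λ − (a²m²/4M²)(1 + 2M/r₀ + a²/r₀²)` (equal since `ω²r₀² = a²m²/(4M²)`), via
`(r₀² + a²)² − 4M²r₀² = Δ(r₀)(r₀² + 2Mr₀ + a²)`. Requires `r₀² + a² ≠ 0`.
[cite: DafermosRodnianskiShlapentokhrothman2014, Lemma 6.4.2 (proof)] -/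
theorem sepPotential₀_sub_sq_eq_of {r₀ : ℝ} (hr₀ : 2 * M * ω * r₀ = a * m)
    (hA : r₀ ^ 2 + a ^ 2 ≠ 0) :
    sepPotential₀ M a ω m Λ r₀ - ω ^ 2 =
      delta M a r₀ * (Λ - ω ^ 2 * (r₀ ^ 2 + 2 * M * r₀ + a ^ 2)) / (r₀ ^ 2 + a ^ 2) ^ 2 := by
  unfold sepPotential₀ delta
  have hA2 : (r₀ ^ 2 + a ^ 2) ^ 2 ≠ 0 := pow_ne_zero 2 hA
  rw [eq_div_iff hA2, sub_mul, div_mul_cancel₀ _ hA2]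
  have e1 : 4 * M * r₀ * a * m * ω = 4 * M * r₀ * ω * (2 * M * ω * r₀) := by rw [hr₀]; ring
  have e2 : a ^ 2 * (m : ℝ) ^ 2 = (2 * M * ω * r₀) ^ 2 := by rw [hr₀]; ring
  rw [e1, e2]
  ring

/-- Case 3 of Lemma 6.4.2, step (i): `ω² · 4M²r² ≤ a²Λ` from `0 < mω ≤ am²/(2Mr)` (square and
cancel `m² > 0`) and `m² ≤ Λ`; the source: "`ω² ∼` … `r₀` will satisfy `r₀ ∈ [r₊ + δ, R]`".
[cite: DafermosRodnianskiShlapentokhrothman2014, Lemma 6.4.2 (proof)] -/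
private theorem c3_omega_sq_le (hM : 0 < M) {r : ℝ} (hr : 0 < r) (hpos : 0 < (m : ℝ) * ω)
    (hsr : m * ω ≤ a * (m : ℝ) ^ 2 / (2 * M * r)) (hq : (m : ℝ) ^ 2 ≤ Λ) :
    ω ^ 2 * (4 * M ^ 2 * r ^ 2) ≤ a ^ 2 * Λ := by
  have hm0 : (m : ℝ) ≠ 0 := by rintro h0; rw [h0] at hpos; simp at hpos
  have hm2 : 0 < (m : ℝ) ^ 2 := by positivity
  have h1 : (m : ℝ) * ω * (2 * M * r) ≤ a * (m : ℝ) ^ 2 := by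
    rwa [le_div_iff₀ (by positivity)] at hsr
  have h2 : ((m : ℝ) * ω * (2 * M * r)) ^ 2 ≤ (a * (m : ℝ) ^ 2) ^ 2 :=
    pow_le_pow_left₀ (by positivity) h1 2
  have e1 : ((m : ℝ) * ω * (2 * M * r)) ^ 2 = ω ^ 2 * (4 * M ^ 2 * r ^ 2) * (m : ℝ) ^ 2 := by
    ring
  have e2 : (a * (m : ℝ) ^ 2) ^ 2 = a ^ 2 * (m : ℝ) ^ 2 * (m : ℝ) ^ 2 := by ring
  rw [e1, e2] at h2
  have h4 : ω ^ 2 * (4 * M ^ 2 * r ^ 2) ≤ a ^ 2 * (m : ℝ) ^ 2 := le_of_mul_le_mul_right h2 hm2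
  exact h4.trans (mul_le_mul_of_nonneg_left hq (sq_nonneg a))

/-- Case 3 of Lemma 6.4.2, step (ii): `(r₀ − r)²ω² = r²·(2Mrω − am)²/(4M²r²)` when
`2Mωr₀ = am` (so `r₀ − r = (am − 2Mωr)/(2Mω)`). [cite: DafermosRodnianskiShlapentokhrothman2014, Lemma 6.4.2 (proof)] -/
private theorem c3_diff_sq (hM : 0 < M) {r : ℝ} (hr : 0 < r) (hω : ω ≠ 0) {r₀ : ℝ}
    (hr₀ : 2 * M * ω * r₀ = a * m) :
    (r₀ - r) ^ 2 * ω ^ 2 = r ^ 2 * ((2 * M * r * ω - a * m) ^ 2 / (4 * M ^ 2 * r ^ 2)) := by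
  have e : r₀ = a * m / (2 * M * ω) := by
    field_simp
    linarith [hr₀]
  rw [e]
  field_simp
  ring

/-- Case 3 of Lemma 6.4.2, step (iii): the lower bound `(r₀ − r₊)² > 4M⁴ε₁` ("`r₀` is bounded
away from `r₊` … independently of the frequency parameters"): from `r²ε₁Λ < (r₀ − r)²ω²`,
`ω²·4M²r² ≤ a²Λ ≤ M²Λ` and `r ≥ M`. [cite: DafermosRodnianskiShlapentokhrothman2014, Lemma 6.4.2 (proof)] -/
private theorem c3_lower (hM : 0 < M) {r : ℝ} (hrM : M ≤ r) (hΛ : 0 ≤ Λ) (ha2 : a ^ 2 ≤ M ^ 2)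
    {ε₁ s : ℝ} (hε₁ : 0 ≤ ε₁) (hs : 0 ≤ s)
    (h1 : r ^ 2 * (ε₁ * Λ) < s * ω ^ 2) (hω_up : ω ^ 2 * (4 * M ^ 2 * r ^ 2) ≤ a ^ 2 * Λ) :
    4 * M ^ 4 * ε₁ < s := by
  have hr : 0 < r := hM.trans_le hrM
  have k1 : r ^ 2 * (ε₁ * Λ) * (4 * M ^ 2 * r ^ 2) < s * ω ^ 2 * (4 * M ^ 2 * r ^ 2) :=
    mul_lt_mul_of_pos_right h1 (by positivity)
  have k2 : s * ω ^ 2 * (4 * M ^ 2 * r ^ 2) ≤ s * (M ^ 2 * Λ) := by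
    have := mul_le_mul_of_nonneg_left (hω_up.trans (mul_le_mul_of_nonneg_right ha2 hΛ)) hs
    linarith
  have k3 : r ^ 2 * (ε₁ * Λ) * (4 * M ^ 2 * r ^ 2) < s * (M ^ 2 * Λ) := k1.trans_le k2
  have hΛpos : 0 < Λ := by
    rcases hΛ.eq_or_lt with h | h
    · rw [← h] at k3; simp at k3
    · exact h
  have k4 : 4 * r ^ 4 * ε₁ * (M ^ 2 * Λ) < s * (M ^ 2 * Λ) := by
    have : r ^ 2 * (ε₁ * Λ) * (4 * M ^ 2 * r ^ 2) = 4 * r ^ 4 * ε₁ * (M ^ 2 * Λ) := by ring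
    linarith
  have k5 : 4 * r ^ 4 * ε₁ < s := lt_of_mul_lt_mul_right k4 (by positivity)
  have k6 : M ^ 4 ≤ r ^ 4 := pow_le_pow_left₀ hM.le hrM 4
  have k7 := mul_le_mul_of_nonneg_right k6 (show 0 ≤ 4 * ε₁ by positivity)
  linarith

/-- Case 3 of Lemma 6.4.2, step (iv): `r₀ > r`, for `0 < mω ≤ am²/(2Mr)`, `2Mωr₀ = am` and
`r₀ ≠ r` (`(r₀ − r)·2Mω²·m² = mω(am² − 2Mr·mω) ≥ 0`). [cite: DafermosRodnianskiShlapentokhrothman2014, Lemma 6.4.2 (proof)] -/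
private theorem c3_gt (hM : 0 < M) {r : ℝ} (hr : 0 < r) (hpos : 0 < (m : ℝ) * ω)
    (hsr : m * ω ≤ a * (m : ℝ) ^ 2 / (2 * M * r)) {r₀ : ℝ} (hr₀ : 2 * M * ω * r₀ = a * m)
    (hne : r₀ - r ≠ 0) : r < r₀ := by
  have hω0 : ω ≠ 0 := by rintro rfl; simp at hpos
  have hm0 : (m : ℝ) ≠ 0 := by rintro h0; rw [h0] at hpos; simp at hpos
  have hm2 : 0 < (m : ℝ) ^ 2 := by positivity
  have hsign : 2 * M * r * ((m : ℝ) * ω) ≤ a * (m : ℝ) ^ 2 := by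
    rw [le_div_iff₀ (by positivity)] at hsr; linarith
  have e1 : (r₀ - r) * (2 * M * ω ^ 2) = a * ((m : ℝ) * ω) - 2 * M * r * ω ^ 2 := by
    have : a * ((m : ℝ) * ω) = ω * (2 * M * ω * r₀) := by rw [hr₀]; ring
    rw [this]; ring
  have e2 : (a * ((m : ℝ) * ω) - 2 * M * r * ω ^ 2) * (m : ℝ) ^ 2 =
      ((m : ℝ) * ω) * (a * (m : ℝ) ^ 2 - 2 * M * r * ((m : ℝ) * ω)) := by ring
  have h1 : 0 * (m : ℝ) ^ 2 ≤ (a * ((m : ℝ) * ω) - 2 * M * r * ω ^ 2) * (m : ℝ) ^ 2 := by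
    rw [zero_mul, e2]; exact mul_nonneg hpos.le (by linarith)
  have h2 : 0 ≤ a * ((m : ℝ) * ω) - 2 * M * r * ω ^ 2 := le_of_mul_le_mul_right h1 hm2
  have h3 : 0 * (2 * M * ω ^ 2) ≤ (r₀ - r) * (2 * M * ω ^ 2) := by
    rw [zero_mul, e1]; exact h2
  have h4 : 0 ≤ r₀ - r := le_of_mul_le_mul_right h3 (by positivity)
  exact sub_pos.1 (lt_of_le_of_ne h4 (Ne.symm hne))

/-- Case 3 of Lemma 6.4.2, step (v): the upper bound `r₀ < 19M` ("`R < ∞`") for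
`0 < mω ≤ am²/(2Mr)`, `m² ≤ Λ`, `ω² > 4Λ/(289M²)`, `0 ≤ a ≤ M ≤ r`, `2Mωr₀ = am`:
`r₀·2Mω² = a·mω ≤ a²m²/(2Mr) ≤ m²/2 < 289M²ω²/8`. [cite: DafermosRodnianskiShlapentokhrothman2014, Lemma 6.4.2 (proof)] -/
private theorem c3_lt (hM : 0 < M) (ha0 : 0 ≤ a) (haM : a ≤ M) {r : ℝ} (hrM : M ≤ r)
    (hpos : 0 < (m : ℝ) * ω) (hsr : m * ω ≤ a * (m : ℝ) ^ 2 / (2 * M * r))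
    (hq : (m : ℝ) ^ 2 ≤ Λ) (hω : 4 / (289 * M ^ 2) * Λ < ω ^ 2) {r₀ : ℝ}
    (hr₀ : 2 * M * ω * r₀ = a * m) : r₀ < 19 * M := by
  have hr : 0 < r := hM.trans_le hrM
  have hω0 : ω ≠ 0 := by rintro rfl; simp at hpos
  have hω2 : 0 < ω ^ 2 := by positivity
  have k1 : r₀ * (2 * M * ω ^ 2) ≤ a * (a * (m : ℝ) ^ 2 / (2 * M * r)) := by
    have : r₀ * (2 * M * ω ^ 2) = a * ((m : ℝ) * ω) := by
      have : a * ((m : ℝ) * ω) = ω * (2 * M * ω * r₀) := by rw [hr₀]; ring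
      rw [this]; ring
    rw [this]; exact mul_le_mul_of_nonneg_left hsr ha0
  have k2 : a * (a * (m : ℝ) ^ 2 / (2 * M * r)) ≤ (m : ℝ) ^ 2 / 2 := by
    rw [show a * (a * (m : ℝ) ^ 2 / (2 * M * r)) = a ^ 2 * (m : ℝ) ^ 2 / (2 * M * r) by ring,
      div_le_div_iff₀ (by positivity) (by norm_num)]
    have : a ^ 2 ≤ M * r := by nlinarith
    nlinarith [mul_le_mul_of_nonneg_right this (sq_nonneg (m : ℝ))]
  have k3 : Λ < 289 * M ^ 2 / 4 * ω ^ 2 := by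
    have h := mul_lt_mul_of_pos_left hω (show 0 < 289 * M ^ 2 / 4 by positivity)
    have e : 289 * M ^ 2 / 4 * (4 / (289 * M ^ 2) * Λ) = Λ := by field_simp
    linarith
  have k4 : r₀ * (2 * M * ω ^ 2) < 289 * M / 16 * (2 * M * ω ^ 2) := by
    have e : 289 * M / 16 * (2 * M * ω ^ 2) = 289 * M ^ 2 / 4 * ω ^ 2 / 2 := by ring
    rw [e]
    linarith [k1.trans k2]
  have k5 : r₀ < 289 * M / 16 := lt_of_mul_lt_mul_right k4 (by positivity)
  linarith

/-- Case 3 of Lemma 6.4.2, step (vi): the value. For `0 < M`, `0 ≤ a < M`, `m² ≤ Λ`,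
`2Mωr₀ = am`, `r₊ < r₀ < 19M` and `(r₀ − r₊)² ≥ 4M⁴ε₁` (`ε₁ ≥ 0`):
`V₀(r₀) − ω² ≥ 4ε₁(M² − a²)Λ/(362²M²)`, from the identity `sepPotential₀_sub_sq_eq_of`,
`Δ(r₀) = (r₀ − r₊)(r₀ − r₋) ≥ (r₀ − r₊)²`, `ω²(r₀² + 2Mr₀ + a²) ≤ 4ω²r₀² = a²m²/M² ≤ a²Λ/M²` ("we
now recall that `a < M < r₀` and that `Λ ≥ |m|(|m| + 1)`") and `(r₀² + a²)² ≤ (362M²)²`.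
[cite: DafermosRodnianskiShlapentokhrothman2014, Lemma 6.4.2 (proof)] -/
private theorem c3_value (hM : 0 < M) (ha0 : 0 ≤ a) (haM : a < M) (hq : (m : ℝ) ^ 2 ≤ Λ)
    {r₀ : ℝ} (hr₀ : 2 * M * ω * r₀ = a * m) (hr₀r : rPlus M a < r₀) (hr₀up : r₀ < 19 * M)
    {ε₁ : ℝ} (hε₁ : 0 ≤ ε₁) (hlow : 4 * M ^ 4 * ε₁ ≤ (r₀ - rPlus M a) ^ 2) :
    4 * ε₁ * (M ^ 2 - a ^ 2) / (362 ^ 2 * M ^ 2) * Λ ≤ sepPotential₀ M a ω m Λ r₀ - ω ^ 2 := by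
  have h : |a| ≤ M := by rw [abs_of_nonneg ha0]; exact haM.le
  have hMa : IsSubextremal M a := show |a| < M by rwa [abs_of_nonneg ha0]
  have hrM : M < rPlus M a := M_lt_rPlus' hMa
  have hΛ : 0 ≤ Λ := (sq_nonneg _).trans hq
  set r := rPlus M a with hr_def
  have hr₀M : M < r₀ := hrM.trans hr₀r
  have hr₀pos : 0 < r₀ := hM.trans hr₀M
  have ha2 : a ^ 2 ≤ M ^ 2 := by nlinarith
  have hA : r₀ ^ 2 + a ^ 2 ≠ 0 := by positivity
  rw [sepPotential₀_sub_sq_eq_of (Λ := Λ) hr₀ hA, le_div_iff₀ (by positivity)]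
  have hΔ : (r₀ - r) ^ 2 ≤ delta M a r₀ := by
    rw [delta_eq_mul h r₀, ← hr_def, sq]
    exact mul_le_mul_of_nonneg_left (by linarith [rMinus_le_rPlus M a]) (sub_nonneg.2 hr₀r.le)
  have hbr : (M ^ 2 - a ^ 2) * Λ ≤ M ^ 2 * (Λ - ω ^ 2 * (r₀ ^ 2 + 2 * M * r₀ + a ^ 2)) := by
    have h1 : r₀ ^ 2 + 2 * M * r₀ + a ^ 2 ≤ 4 * r₀ ^ 2 := by nlinarith
    have h2 : ω ^ 2 * (r₀ ^ 2 + 2 * M * r₀ + a ^ 2) ≤ ω ^ 2 * (4 * r₀ ^ 2) :=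
      mul_le_mul_of_nonneg_left h1 (sq_nonneg ω)
    have h3 : ω ^ 2 * (4 * r₀ ^ 2) * M ^ 2 = a ^ 2 * (m : ℝ) ^ 2 := by
      have e : (2 * M * ω * r₀) ^ 2 = (a * (m : ℝ)) ^ 2 := by rw [hr₀]
      nlinarith [e]
    have h4 := mul_le_mul_of_nonneg_right h2 (sq_nonneg M)
    nlinarith [mul_le_mul_of_nonneg_left hq (sq_nonneg a)]
  have hden : (r₀ ^ 2 + a ^ 2) ^ 2 ≤ (362 * M ^ 2) ^ 2 := by
    have h1 : r₀ ^ 2 < (19 * M) ^ 2 := pow_lt_pow_left₀ hr₀up hr₀pos.le (by norm_num)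
    have h2 : r₀ ^ 2 + a ^ 2 ≤ 362 * M ^ 2 := by nlinarith
    exact pow_le_pow_left₀ (by positivity) h2 2
  have hMa2 : 0 ≤ M ^ 2 - a ^ 2 := by nlinarith
  have hΔ0 : 0 ≤ delta M a r₀ := (sq_nonneg _).trans hΔ
  have hP : 0 ≤ (M ^ 2 - a ^ 2) * Λ := mul_nonneg hMa2 hΛ
  calc 4 * ε₁ * (M ^ 2 - a ^ 2) / (362 ^ 2 * M ^ 2) * Λ * (r₀ ^ 2 + a ^ 2) ^ 2
      ≤ 4 * ε₁ * (M ^ 2 - a ^ 2) / (362 ^ 2 * M ^ 2) * Λ * (362 * M ^ 2) ^ 2 := by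
        have : 0 ≤ 4 * ε₁ * (M ^ 2 - a ^ 2) / (362 ^ 2 * M ^ 2) * Λ := by positivity
        exact mul_le_mul_of_nonneg_left hden this
    _ = (4 * M ^ 4 * ε₁) * ((M ^ 2 - a ^ 2) * Λ) / M ^ 2 := by field_simp
    _ ≤ (r₀ - r) ^ 2 * ((M ^ 2 - a ^ 2) * Λ) / M ^ 2 := by gcongr
    _ ≤ delta M a r₀ * (M ^ 2 * (Λ - ω ^ 2 * (r₀ ^ 2 + 2 * M * r₀ + a ^ 2))) / M ^ 2 := by
        gcongr
    _ = delta M a r₀ * (Λ - ω ^ 2 * (r₀ ^ 2 + 2 * M * r₀ + a ^ 2)) := by field_simp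

/-- **Case 3 of Lemma 6.4.2** (intermediate frequencies), assembled: for `0 < M`, `0 ≤ a < M`,
an admissible triple with `0 < mω ≤ am²/(2Mr₊)`, `ε₁ ≥ 0`,
`(2Mr₊ω − am)²/(4M²r₊²) > ε₁Λ` and `ω² > 4Λ/(289M²)`, the point `r₀ = am/(2Mω)` lies in
`(r₊, 19M)` and `V₀(r₀) − ω² ≥ 4ε₁(M² − a²)Λ/(362²M²)`. [cite: DafermosRodnianskiShlapentokhrothman2014, Lemma 6.4.2 (proof)] -/
private theorem notTrapped_case3 (hM : 0 < M) (ha0 : 0 ≤ a) (haM : a < M)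
    (hadm : IsAdmissibleTriple a ω m Λ) (hpos : 0 < (m : ℝ) * ω)
    (hsr : m * ω ≤ a * (m : ℝ) ^ 2 / (2 * M * rPlus M a))
    {ε₁ : ℝ} (hε₁ : 0 ≤ ε₁)
    (hD : ε₁ * Λ < (2 * M * rPlus M a * ω - a * m) ^ 2 / (4 * M ^ 2 * rPlus M a ^ 2))
    (hω : 4 / (289 * M ^ 2) * Λ < ω ^ 2) :
    rPlus M a < a * m / (2 * M * ω) ∧
      4 * ε₁ * (M ^ 2 - a ^ 2) / (362 ^ 2 * M ^ 2) * Λ ≤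
        sepPotential₀ M a ω m Λ (a * m / (2 * M * ω)) - ω ^ 2 := by
  have hMa : IsSubextremal M a := show |a| < M by rwa [abs_of_nonneg ha0]
  have hrM : M < rPlus M a := M_lt_rPlus' hMa
  set r := rPlus M a with hr_def
  have hr0 : 0 < r := hM.trans hrM
  have hΛ := hadm.nonneg
  have hq := hadm.sq_le
  have ha2 : a ^ 2 ≤ M ^ 2 := by nlinarith
  have hω0 : ω ≠ 0 := by rintro rfl; simp at hpos
  set r₀ := a * m / (2 * M * ω) with hr₀_def
  have hr₀ω : 2 * M * ω * r₀ = a * m := by rw [hr₀_def]; field_simp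
  have hω_up := c3_omega_sq_le hM hr0 hpos hsr hq
  have h1 : r ^ 2 * (ε₁ * Λ) < (r₀ - r) ^ 2 * ω ^ 2 := by
    rw [c3_diff_sq hM hr0 hω0 hr₀ω]; exact mul_lt_mul_of_pos_left hD (by positivity)
  have hlow : 4 * M ^ 4 * ε₁ < (r₀ - r) ^ 2 :=
    c3_lower hM hrM.le hΛ ha2 hε₁ (sq_nonneg _) h1 hω_up
  have hne : r₀ - r ≠ 0 := fun h0 ↦ by
    rw [h0] at hlow
    have : 0 ≤ 4 * M ^ 4 * ε₁ := by positivity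
    linarith [hlow]
  have hr₀r : r < r₀ := c3_gt hM hr0 hpos hsr hr₀ω hne
  have hr₀up : r₀ < 19 * M := c3_lt hM ha0 haM.le hrM.le hpos hsr hq hω hr₀ω
  exact ⟨hr₀r, c3_value hM ha0 haM hq hr₀ω hr₀r hr₀up hε₁ hlow.le⟩

/-- **DRSR Lemma 6.4.2 (superradiant frequencies are not trapped), `α = 0`, explicit form.**
Let `0 < M`, `0 ≤ a < M`. There is `b = b(M, a) > 0` such that for every admissible frequency
triple `(ω, m, Λ)` in the superradiant regime `0 < mω ≤ am²/(2Mr₊)` there is `r > r₊` with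
`V₀(r) − ω² ≥ bΛ`. The proof follows the source's three cases with
`B₀ = 4(r₊ − M)(Mr₊ − a²)`, `δ = min(B₀/(200M²), M)`, `ε₁ = δB₀/(4000M⁶)`,
`b = min(ε₁, 4/(289M²), 4ε₁(M² − a²)/(362²M²))`: near the threshold
(`(2Mr₊ω − am)²/(4M²r₊²) ≤ ε₁Λ`) the point `r₊ + δ`; for `ω² ≤ 4Λ/(289M²)` the point `4M`;
otherwise `r₀ = am/(2Mω)`. Not transcribed: the extension "for all `α ≥ 0` sufficiently small" to
`mω ≤ am²/(2Mr₊) + αΛ`, and the uniformity of `b` in `a ≤ a₀` (the source's `b = b(a₀, M)`).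
As in loc. cit. the statement uses the reduction to `a ≥ 0` (§4.2); for `a = 0` it is vacuous.
[cite: DafermosRodnianskiShlapentokhrothman2014, Lemma 6.4.2] -/
theorem exists_sepPotential₀_sub_sq_ge (hM : 0 < M) (ha0 : 0 ≤ a) (haM : a < M) :
    ∃ b > 0, ∀ (ω : ℝ) (m : ℤ) (Λ : ℝ), IsAdmissibleTriple a ω m Λ → 0 < (m : ℝ) * ω →
      m * ω ≤ a * (m : ℝ) ^ 2 / (2 * M * rPlus M a) →
      ∃ r, rPlus M a < r ∧ b * Λ ≤ sepPotential₀ M a ω m Λ r - ω ^ 2 := by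
  have hMa : IsSubextremal M a := show |a| < M by rwa [abs_of_nonneg ha0]
  have hrM : M < rPlus M a := M_lt_rPlus' hMa
  have hr2 : rPlus M a ≤ 2 * M := rPlus_le_two_mul' hM.le a
  set r := rPlus M a with hr_def
  set B₀ := 4 * (r - M) * (M * r - a ^ 2) with hB₀_def
  have hB₀ : 0 < B₀ := mul_pos (mul_pos (by norm_num) (by linarith)) (by nlinarith)
  set δ := min (B₀ / (200 * M ^ 2)) M with hδ_def
  have hδ : 0 < δ := lt_min (by positivity) hM
  have hδM : δ ≤ M := min_le_right _ _
  have hδB : 200 * M ^ 2 * δ ≤ B₀ := by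
    have h1 : δ ≤ B₀ / (200 * M ^ 2) := min_le_left _ _
    rw [le_div_iff₀ (by positivity)] at h1
    linarith
  set ε₁ := δ * B₀ / (4000 * M ^ 6) with hε₁_def
  have hε₁ : 0 < ε₁ := by positivity
  have hMa2 : 0 < M ^ 2 - a ^ 2 := by nlinarith
  set b := min (min ε₁ (4 / (289 * M ^ 2))) (4 * ε₁ * (M ^ 2 - a ^ 2) / (362 ^ 2 * M ^ 2))
    with hb_def
  have hb : 0 < b := lt_min (lt_min hε₁ (by positivity)) (by positivity)
  refine ⟨b, hb, fun ω m Λ hadm hpos hsr ↦ ?_⟩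
  have hΛ := hadm.nonneg
  by_cases h1 : (2 * M * r * ω - a * m) ^ 2 / (4 * M ^ 2 * r ^ 2) ≤ ε₁ * Λ
  · refine ⟨r + δ, by linarith, ?_⟩
    have := notTrapped_case1 hM ha0 haM hadm hsr hδ hδM hδB h1
    exact (mul_le_mul_of_nonneg_right ((min_le_left _ _).trans (min_le_left _ _)) hΛ).trans this
  · by_cases h2 : ω ^ 2 ≤ 4 / (289 * M ^ 2) * Λ
    · refine ⟨4 * M, by linarith, ?_⟩
      exact (mul_le_mul_of_nonneg_right ((min_le_left _ _).trans (min_le_right _ _)) hΛ).trans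
        (notTrapped_case2 hM ha0 haM hadm hpos h2)
    · obtain ⟨hr₀, hval⟩ := notTrapped_case3 hM ha0 haM hadm hpos hsr hε₁.le (not_le.1 h1)
        (not_le.1 h2)
      exact ⟨_, hr₀, (mul_le_mul_of_nonneg_right (min_le_right _ _) hΛ).trans hval⟩

/-- **DRSR Lemma 6.4.2 in the printed form `bΛ ≤ V₀(r⁰_max) − ω²`** (with Lemma 6.4.1): for
`0 < M`, `0 ≤ a < M` there is `b = b(M, a) > 0` such that for every admissible triple with
`0 < mω ≤ am²/(2Mr₊)` the potential `V₀` has a unique critical point `r⁰_max ∈ (r₊, 7M)` on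
`(r₊, ∞)`, which is its global maximum there, and `V₀(r⁰_max) − ω² ≥ bΛ` ("the maximum of `V` is
always (quantitatively) above the energy level `ω²`"; `Λ > 0` is automatic since `m ≠ 0`).
Same scope as `exists_sepPotential₀_sub_sq_ge` (`α = 0`; `b` not packaged uniformly in
`a ≤ a₀`). [cite: DafermosRodnianskiShlapentokhrothman2014, Lemma 6.4.2] -/
theorem exists_sepPotential₀_rmax_sub_sq_ge (hM : 0 < M) (ha0 : 0 ≤ a) (haM : a < M) :
    ∃ b > 0, ∀ (ω : ℝ) (m : ℤ) (Λ : ℝ), IsAdmissibleTriple a ω m Λ → 0 < (m : ℝ) * ω →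
      m * ω ≤ a * (m : ℝ) ^ 2 / (2 * M * rPlus M a) →
      ∃ rmax, rPlus M a < rmax ∧ rmax < 7 * M ∧
        IsMaxOn (sepPotential₀ M a ω m Λ) (Ioi (rPlus M a)) rmax ∧
        deriv (sepPotential₀ M a ω m Λ) rmax = 0 ∧
        (∀ r ∈ Ioi (rPlus M a), r ≠ rmax → deriv (sepPotential₀ M a ω m Λ) r ≠ 0) ∧
        b * Λ ≤ sepPotential₀ M a ω m Λ rmax - ω ^ 2 := by
  have hMa : IsSubextremal M a := show |a| < M by rwa [abs_of_nonneg ha0]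
  obtain ⟨b, hb, H⟩ := exists_sepPotential₀_sub_sq_ge hM ha0 haM
  refine ⟨b, hb, fun ω m Λ hadm hpos hsr ↦ ?_⟩
  have hm0 : (m : ℝ) ≠ 0 := by rintro h0; rw [h0] at hpos; simp at hpos
  have hΛ : 0 < Λ := lt_of_lt_of_le (by positivity) hadm.sq_le
  have hαs : 4 * a * M * 0 * (3 * rPlus M a ^ 2 - a ^ 2) <
      4 * (rPlus M a - M) * (M * rPlus M a - a ^ 2) := by
    have := deriv_sepPotential₀_rPlus_const_pos hMa
    have hr : 0 < rPlus M a := rPlus_pos' hMa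
    have hA3 : 0 < (rPlus M a ^ 2 + a ^ 2) ^ 3 := by positivity
    rw [mul_zero, zero_mul]
    exact (div_pos_iff_of_pos_right hA3).1 this
  obtain ⟨rmax, h1, h7, hposd, h0, hnegd⟩ :=
    sepPotential₀_caseB_of_superradiant hM ha0 haM hadm hΛ le_rfl hαs (by simpa using hsr)
  obtain ⟨-, -, hmax⟩ :=
    sepPotential₀_isMaxOn_of_deriv_sign (ω := ω) (Λ := Λ) hMa h1 hposd hnegd
  obtain ⟨r, hr, hbr⟩ := H ω m Λ hadm hpos hsr
  have hle : sepPotential₀ M a ω m Λ r ≤ sepPotential₀ M a ω m Λ rmax :=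
    isMaxOn_iff.1 hmax r hr
  refine ⟨rmax, h1, h7, hmax, h0, fun s hs hne ↦ ?_, hbr.trans (by linarith)⟩
  rcases lt_or_gt_of_ne hne with h | h
  · exact (hposd s ⟨hs, h⟩).ne'
  · exact (hnegd s h).ne

end Trichotomy

end Kerr

end Literature.Geometry.Lorentzian

end
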